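import Literature.Geometry.Lorentzian.KerrDecayHierarchy
import Literature.Geometry.Lorentzian.KerrHyperboloidalLeaves
import Literature.Geometry.Lorentzian.KerrSchildEnergyEstimate
import Literature.Geometry.Lorentzian.KerrDomainOfDependence
import HarnessLib

/-!
# Towards DRSR Theorems 3.1–3.2 for the leaves `Σ̃_τ(h♯_{R₁})`: the space-time form of the
# time-integrated leaf functionals of `KerrDecayHierarchy.lean`

(statement group **gr.S24**; namespace `Literature.Geometry.Lorentzian.Kerr`, measure theory in
`Literature.Geometry.Lorentzian.E4`)

`KerrDecayHierarchy.lean` states the two named facts on which the gr.S24 decay chain rests —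
fact A, `Kerr.drsr_theorems_3_1_3_2_scri` (Dafermos–Rodnianski–Shlapentokh-Rothman,
arXiv:1402.7034 = Ann. of Math. 183 (2016), "DRSR", Thm. 3.1 (20), (23), Thm. 3.2 (25), (28) in the
§3.3 form for the hyperboloidal leaves `Σ̃_τ(h♯_{R₁}) = {t*_KS = τ + h♯_{R₁}(y)}`), and fact B,
`Kerr.dafermosRodnianski_pHierarchy_scri` (the far-region `r^p` estimates with their printed local
error terms) — with every space-time integral written as a *time integral of a leaf functional*:
`∫_{[s,t]} localLeafFlux(τ, R) dτ` in (A4), `∫_{[s,t]} localLeafMass(τ, R) dτ` in (A8), and their sum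
`Kerr.localError … R s t` on the right-hand sides of (B1)–(B3). The printed estimates, on the
other hand, are space-time integrals over `D⁺(Σ̃_s) ∩ J⁻(Σ̃_t)`: the left-hand sides of (20), (25)
are `∫_{𝓡} (…) dVol`, and the error terms of the `r^p` hierarchy are
`∫_{𝓡(τ₁,τ₂) ∩ {r ∼ R}} (|∂φ|² + |φ|²) dVol` (Moschidis, arXiv:1509.08489, Thm. 5.1; Dafermos–Rodnianski,
arXiv:0910.4957, §3–§4). The docstrings of `Kerr.localError` and of clause (A4) assert the
identification of the two — "under `(τ, y) ↦ (τ + h♯(y), y)` (Jacobian `1`; `dt* dy` is the metric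
volume of the Kerr–Schild chart, `det g = −1`) this is the space-time integral of
`T[ψ](V, W) + ψ²` over the region between `Σ̃_s(h)` and `Σ̃_t(h)` above the ball". This file
**proves** that identification, the first of the standard identifications through which any
proof of facts A and B from the printed theorems has to pass (D-0026: proved bottom-up, no new
named fact is introduced; facts A and B themselves remain named facts):

* `E4.timeSplit_apply`, `E4.measurePreserving_leafShear` (**proved**): the shear
  `(t*, y) ↦ (t* + h(y), y)` of the Kerr–Schild chart along the `t*`-lines preserves Lebesgue
  measure `dt* dy` for every measurable height `h` (Fubini: a translation in `t*` fibrewise;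
  Mathlib's `MeasurePreserving.skew_product` conjugated by `E4.timeSplit`);
* `Kerr.lintegral_lintegral_leafPoint_eq` (**proved**, the general reparametrisation): for
  measurable `h`, `G : E4 → [0, ∞]`, `S ⊆ ℝ`, `B ⊆ E3`,
  `∫_{τ ∈ S} ∫_{y ∈ B} G(τ + h(y), y) dy dτ = ∫_{{x | x⃗ ∈ B, x⁰ − h(x⃗) ∈ S}} G dVol` — the union of the
  parts over `B` of the leaves `Σ̃_τ(h)`, `τ ∈ S`, carries the measure `dτ dy`;
* `Kerr.contDiff_cutoffHeight`, `Kerr.contDiff_scriHeight` (**proved**): the cut-off heights, in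
  particular `h♯_{R₁}` for `R₁ > r₊`, are `C^∞` on all of `E3` (they vanish identically near the
  closed set `{r(0, ·) ≤ r₊}`, and are smooth on the exterior slice, `Kerr.contDiffOn_cutoffHeight`);
* `Kerr.continuous_nullVector_restrict`, `Kerr.continuous_timeVector_restrict`,
  `Kerr.continuous_dcov_apply_of_continuous`, `Kerr.continuous_leafNormal`,
  `Kerr.continuous_stressEnergy_timeVector_leafNormal` (**proved**): for a `C¹` height `h` and a
  smooth `ψ` the flux density `x ↦ T[ψ](V, W_h)(x)`, `W_h = −g♯ d(t* − h)`, is continuous on the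
  exterior chart (explicit Kerr–Schild components: `Kerr.sharp_smoothMetric`,
  `Kerr.gradSq_smoothMetric`, `Kerr.bilin_timeVector_leafNormal`);
* `Kerr.spacetimeFluxDensity`, `Kerr.spacetimeMassDensity` (definitions): the densities
  `1_{r > r₊} T[ψ](V, W_h)` and `1_{r > r₊} ψ²` as `[0, ∞]`-valued functions on `E4`, of which
  `Kerr.leafFluxDensity … τ y`, `Kerr.leafMassDensity … τ y` are the values at the leaf point
  `(τ + h(y), y)` (`rfl`), measurable for smooth `ψ` and `C¹` `h`
  (`Kerr.measurable_spacetimeFluxDensity`, `Kerr.measurable_spacetimeMassDensity`);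
* `Kerr.leafSlab h R s t` (definition): the region
  `{x | ‖x⃗‖ ≤ R, s + h(x⃗) ≤ x⁰ ≤ t + h(x⃗)}` between the leaves `Σ̃_s(h)` and `Σ̃_t(h)` over the closed
  coordinate ball of radius `R` — for `h = h♯_{R₁}` and `R ≤ R₁` the coordinate cylinder
  `[s, t] × B̄_R` (`Kerr.leafSlab_scriHeight_of_le`), in general a sheared cylinder contained in
  `{t* ≥ s}` when `h ≥ 0` (`Kerr.le_time_of_mem_leafSlab`);
* `Kerr.setLIntegral_localLeafFlux_eq`, `Kerr.setLIntegral_localLeafMass_eq` (any measurable set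
  of leaf labels), `Kerr.lintegral_localLeafFlux_eq_setLIntegral`,
  `Kerr.lintegral_localLeafMass_eq_setLIntegral`, `Kerr.localError_eq_setLIntegral` (**proved**):
  `∫_{[s,t]} localLeafFlux(τ, R) dτ = ∫_{leafSlab h R s t} 1_{r>r₊} T[ψ](V, W_h) dVol`,
  `∫_{[s,t]} localLeafMass(τ, R) dτ = ∫_{leafSlab h R s t} 1_{r>r₊} ψ² dVol`, and
  `localError … ψ R s t = ∫_{leafSlab h R s t} 1_{r>r₊} (T[ψ](V, W_h) + ψ²) dVol`, for `C¹` heights and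
  smooth `ψ`; specialised to the admissible waves and the leaves `Σ̃_τ(h♯_{R₁})` of facts A and B in
  `Kerr.localError_scriHeight_eq_setLIntegral` and its two companions;
* `Kerr.leafFluxUpper_alg`, `Kerr.stressEnergy_timeVector_leafNormal_le_sum_sq_core`,
  `Kerr.stressEnergy_timeVector_leafNormal_cutoffHeight_le_sum_sq`,
  `Kerr.stressEnergy_timeVector_leafNormal_scriHeight_le_coordEnergyDensity`,
  `Kerr.leafFluxDensity_scriHeight_le_coordEnergyDensity` (**proved**): the upper comparability
  `T[ψ](V, W_h) ≤ 250 ∑_μ (∂_μψ)²` of the flux density through the leaves of every cut-off foliation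
  with far slope `0 ≤ σ ≤ σ♯` (`R₁ ≥ 4M`), at every exterior point — the bound "the flux density is
  `≤ C ∑(∂ψ)²`" of clause (A4) of fact A, with an absolute constant and for every radius (the
  converse of `Kerr.leafCoercivity_pointwise` of `KerrLeafCoercivity.lean`, same component algebra).
  The companion comparisons of the `V`- and `T = ∂_{t*}`-fluxes of clause (A5) (`J^T·n ≤ J^V·n`
  everywhere, `J^V·n ≤ 2 J^T·n` where `H ≤ 1/8`) are `Kerr.stressEnergy_basisVector_zero_le_timeVector`
  and `Kerr.stressEnergy_timeVector_le_two_mul` of `KerrLeafEnergyComparison.lean`.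
* `IsAdmissibleKerrWave.exists_sliceData`, `IsAdmissibleKerrWave.exists_horizonRegular_extension`
  (**proved**, with `E4.fderiv_eq_of_data_eventuallyEq` and `KerrSchild.waveOperator_sub_local`):
  DRSR §4.1 for the class `IsAdmissibleKerrWave` — the data of an admissible wave extend by zero to
  `C_c^∞(ℝ³)` data, and, *assuming the named fact* `KerrSchild.waveCauchyProblem`
  (`KerrSchildWaveCauchyProblem.lean`), every admissible wave coincides on `{t* ≥ 0}` with a smooth
  solution on the horizon-penetrating chart `Kerr.region a r₀`, `0 < r₀ ≤ r₊`, whose data vanish off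
  a compact subset of the open exterior slice (domain of dependence in the exterior,
  `Kerr.vanish_of_data_ball` of `KerrDomainOfDependence.lean`, applied to the difference): the
  regularity up to and through `𝓗⁺` on which the red-shift estimates of DRSR Prop. 4.5.2 act;
* `E4.fderiv_eq_of_eqOn_nonneg_time`, `OpensChart.mfderiv_eq_of_eqOn_nonneg_time`,
  `timeDeriv_eq_of_eqOn_nonneg_time`, `Kerr.stressEnergy_eq_of_eqOn_nonneg_time`,
  `Kerr.leafFluxDensity_eq_of_eqOn_nonneg_time`, `Kerr.leafFlux_eq_of_eqOn_nonneg_time`,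
  `Kerr.localError_eq_of_eqOn_nonneg_time`,
  `IsAdmissibleKerrWave.exists_horizonRegular_extension_leafFunctionals` (**proved**): the
  functionals of fact A through the leaves `Σ̃_τ(h)`, `τ ≥ 0`, `h ≥ 0`, of two smooth functions on
  the exterior agreeing on `{t* ≥ 0}` coincide (also for their time derivatives), so that they may
  be computed on the horizon-regular extension: estimates proved for DRSR's class transfer to the
  admissible wave.

In the ingoing Kerr–Schild chart `√|det g| = 1` (the Kerr–Schild form `g = η + 2H ℓ ⊗ ℓ` with `ℓ`
null has `det g = det η`; Kerr–Schild 1965, §2), so `dVol = dt* dy` is the metric volume and the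
right-hand sides above are the space-time integrals `∫_𝓑 (…)` of DRSR §2.3.2 over
`𝓑 = leafSlab h R s t ⊆ D⁺(Σ̃_s(h)) ∩ {r ≤ R}` (`r ≤ ‖x⃗‖`,
`Kerr.radius_le_spatialNorm`; `D⁺(Σ̃_s) = ⋃_{τ ≥ s} Σ̃_τ`, arXiv:1010.5132, §4.4); the flux density `T[ψ](V, W_h) dy` is
`J^V_μ[ψ] n^μ_{Σ̃_τ} dσ` (module docstring of `KerrHyperboloidalFlux.lean`). Nothing here bears on
the truth of facts A and B (both remain named facts, D-0014); what is settled is that their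
time-integrated error functionals *are* the printed space-time integrals, with no measurability
proviso left over (cf. the remark on `lintegral` superadditivity in the docstring of fact A,
clause (A5)).

## What a proof of fact A still requires (status of the decomposition)

Fact A is DRSR's Theorems 3.1–3.2 themselves, for the whole subextremal range `|a| < M`, in the
§3.3 form for `Σ̃₀ := Σ̃_s(h♯_{R₁})`; its printed proof is §§4–13 of arXiv:1402.7034, resting on
arXiv:1010.5132. In the paper's own logic (§3.4): §4.1 reduces to smooth compactly supported data;
Prop. 4.5.1 supplies the red-shift vector field `N` (`φ_τ`-invariant, timelike on `𝓡 ⊃ 𝓗⁺`,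
`K^N ≥ b J^N_μ N^μ` for `r ≤ r_red`, `N = T` for `r ≥ r₁`), Props. 4.5.2–4.5.3 the red-shift
estimate and commutation, Prop. 4.6.1 the large-`r` estimate; §5 is Carter's separation (oblate
spheroidal harmonics, the "sufficiently integrable, outgoing" solutions of the radial o.d.e.), §6 the
analysis of the potential, §7 the current templates, Thm. 8.1 the frequency-localised o.d.e.
estimates for all admissible frequency triples; §9 sums them: Prop. 9.1.1 is (20)–(22) for
*future-integrable* solutions (Def. 9.1.1), using quantitative mode stability on the real axis
(Shlapentokh-Rothman, AHP 16 (2015) = arXiv:1302.6902; §9.7); Prop. 10.1 is (25)–(27) for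
future-integrable solutions (elliptic estimates, Lemmas 10.1.1 ff., and Prop. 4.5.3); Prop. 11.1 shows
by continuity in `a` (openness §11.2, closedness §11.3) that every solution with `C_c^∞` data is
future-integrable; Prop. 12.1 is the precise integrated decay statement, Prop. 13.1 the boundedness
(23) a posteriori, Prop. 13.3.1 the higher-order boundedness (28); and §3.3 transfers everything from
`Σ₀` to admissible `Σ̃₀` of the second kind by Prop. 4.6.1 of arXiv:1010.5132 ("extending initial
data, an easy domain of dependence argument, and the fact that `T` is timelike … near infinity").
None of these propositions is in the tree (D-0026 forbids vendoring them from a fact-proving seat);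
the library's bottom-up DRSR programme currently covers parts of §§6–8 (`KerrSeparatedPotential*`,
`KerrSeparatedTrapping`, `KerrSeparatedCurrents`, `KerrCombinedCurrent`, `KerrFrequencyRanges`,
`KerrTimeDominatedEstimate`, `KerrLargeSuperradiantPotential`, …) and the first-order, first-kind
statements are the named facts `DafermosRodnianskiShlapentokhRothman2016_energyBoundedness`
(`KerrWaveEnergy.lean`) and `…_integratedDecay` (`KerrIntegratedDecay.lean`). Two structural remarks
for whoever plans the remaining work:

1. The class `IsAdmissibleKerrWave` (data compactly supported in the *open* exterior slice
   `{t* = 0, r > r₊}`) is **not invariant under forward time translation**: `ψ(s, ·)` does not vanish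
   near `𝓗⁺` for `s > 0`. The clauses of fact A "from `Σ̃_s`", `s > 0`, can therefore not be reduced
   to `s = 0` by stationarity inside this class (nor to the first-kind facts: the data of `ψ` on `Σ̃_s`
   are not compactly supported, and the first-kind constants `C(M, a, F)` are not uniform along a
   family of admissible heights hugging `h♯`). DRSR's class — solutions on `D⁺(Σ̃₀)` regular up to and
   including `𝓗⁺ ∩ D⁺(Σ̃₀)` (arXiv:1010.5132, Prop. 4.5.1) — is needed, i.e. the horizon-penetrating
   charts `Kerr.region a r₀`, `r₀ < r₊`, and the extension of an admissible wave across `𝓗⁺` for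
   `t* ≥ 0` (existence: `KerrSchild.waveCauchyProblem` / `Kerr.exists_wave_of_data` of
   `KerrSchildWaveCauchyProblem.lean`; uniqueness in the exterior: `Kerr.vanish_of_data_ball` of
   `KerrDomainOfDependence.lean`). This extension is proved below, conditionally on the named fact
   `KerrSchild.waveCauchyProblem` (`IsAdmissibleKerrWave.exists_horizonRegular_extension`): the
   well-posedness theory is thus the first genuine prerequisite of fact A that exists in the tree
   as an (unproved) named fact. It is needed again, in a more general form, by the continuity
   argument in `a` of §11: the interpolating solution of Def. 11.2.3 solves `□_{g̃_τ} ψ̃_τ = 0` with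
   the same data for the interpolating metrics `g̃_τ = χ_τ g_{å,M} + (1 − χ_τ) g_{a,M}` of Def. 11.2.2,
   which are not of Kerr–Schild form.
2. What this file settles are the identifications between the printed space-time and flux quantities
   and the vendored leaf-wise clauses: the left-hand sides of (A4), (A8) and the error functional of
   fact B are space-time integrals over `Kerr.leafSlab` (Jacobian `1`); the flux density through the
   leaves is dominated by `∑(∂ψ)²` (the lower, degenerate-weight bound being
   `Kerr.leafCoercivity_pointwise` of `KerrLeafCoercivity.lean`); the comparisons `J^T·n ≤ J^V·n`
   everywhere and `J^V·n ≤ 2 J^T·n` where `H ≤ 1/8` ((A5), fact B) are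
   `Kerr.stressEnergy_basisVector_zero_le_timeVector`, `Kerr.stressEnergy_timeVector_le_two_mul` of
   `KerrLeafEnergyComparison.lean`. Not settled here, and not elementary: `ψ_∞ = 0` along
   `Σ̃_s` (radiation field, Hardy), the density argument for the non-compactly-supported data of `ψ`
   on `Σ̃_s`, and the local comparability (29) of `∑_{i≤j−1} ∫ J^N[N^iψ]·n` with a concrete
   second/third-order energy (the `E₂`, `E₃` of fact A are existential for this reason). The
   far-region energy identities between hyperboloidal leaves (smeared future time cut-off, removal by
   monotone convergence) are being developed for fact B in `KerrSchildTruncatedCurrent.lean` and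
   `KerrSchildLeafCurrents.lean`; with `F₁ = 0`, `F₂ = h♯_{R₁}` and those comparisons they also give the bound of the flux through `Σ̃_t(h♯_{R₁})` by the energy on the slice `{t* = t}`, hence
   clause (A1) at `s = 0` from slice boundedness (`drsr_wave_boundedness_kerr_of_DRSR`).

## References

* M. Dafermos, I. Rodnianski, Y. Shlapentokh-Rothman, *Decay for solutions of the wave equation on
  Kerr exterior spacetimes III: the full subextremal case `|a| < M`*, Ann. of Math. 183 (2016)
  787–913, arXiv:1402.7034: §2.2.5–§2.2.6 (the foliation `Σ_τ = φ_τ(Σ₀)`, `𝓡(τ', τ'')`, volume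
  form), §2.3.2 (space-time integrals `∫_𝓑 K^V` between homologous hypersurfaces), Thm. 3.1 (20),
  Thm. 3.2 (25), §3.3 (p. 14: `Σ̃_τ = φ_τ(Σ̃₀)`, `D⁺(Σ̃₀)`) (key `DafermosRodnianskiShlapentokhrothman2014`).
* G. Moschidis, *The `r^p`-weighted energy method of Dafermos and Rodnianski in general
  asymptotically flat spacetimes and applications*, Ann. PDE 2 (2016), arXiv:1509.08489, Thm. 5.1
  (the error terms `∫_{𝓡(τ₁,τ₂)} |∂χ_R| (r^p|∂φ|² + r^{p−2}φ²)`) (key `Moschidis2016`).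
* R. P. Kerr, A. Schild, 1965, §2 (`det g = det η` for Kerr–Schild metrics) (key `KerrSchild1965`).
* M. Dafermos, I. Rodnianski, *Decay for solutions of the wave equation on Kerr exterior
  spacetimes I–II: the cases `|a| ≪ M` or axisymmetry*, arXiv:1010.5132, §4.4 (Def. 4.1, admissible
  hypersurfaces of the first and second kind; `D⁺(Σ) = ⋃_{τ≥0} φ_τ(Σ)`), Prop. 4.5.1
  (well-posedness), §4.6 Prop. 4.6.1 (the reduction) (key `DafermosRodnianski2010KerrSmallA`).
-/

noncomputable section

open Set Filter MeasureTheory Metric TopologicalSpace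
open scoped Topology ENNReal Manifold ContDiff

namespace Literature.Geometry.Lorentzian

/-! ### The shear `(t*, y) ↦ (t* + h(y), y)` preserves the space-time volume `dt* dy` -/

namespace E4

/-- `timeSplit x = (x⁰, x⃗)` (the forward direction of `E4.timeSplit_symm_apply`). [folklore] -/
theorem timeSplit_apply (x : E4) : timeSplit x = (x 0, spatial x) := by
  have h : timeSplit.symm (x 0, spatial x) = x := by
    rw [timeSplit_symm_apply]
    exact ofTimeSpace_time_spatial x
  conv_lhs => rw [← h]
  exact timeSplit.apply_symm_apply _

/-- **The shear along the `t*`-lines preserves Lebesgue measure.** For every measurable height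
function `h : E3 → ℝ`, the map `(t*, y) ↦ (t* + h(y), y)` of the Kerr–Schild chart `E4 = ℝ × E3`
preserves `dt* dy` (fibrewise it is a translation of `ℝ`; Mathlib's
`MeasurePreserving.skew_product`, conjugated by the swap `ℝ × E3 ≃ E3 × ℝ` and by
`E4.timeSplit`). This is the "Jacobian `1`" of the reparametrisation `(τ, y) ↦ (τ + h(y), y)` of
`D⁺(Σ̃₀(h))` by the leaves `Σ̃_τ(h) = φ_τ(Σ̃₀(h))` (DRSR arXiv:1402.7034, §2.2.5, §3.3). [folklore] -/
theorem measurePreserving_leafShear {h : E3 → ℝ} (hh : Measurable h) :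
    MeasurePreserving (fun x : E4 ↦ ofTimeSpace (x 0 + h (spatial x)) (spatial x)) volume volume := by
  -- the fibrewise translation on `E3 × ℝ`
  have h1 : MeasurePreserving (fun p : E3 × ℝ ↦ (p.1, p.2 + h p.1))
      ((volume : Measure E3).prod (volume : Measure ℝ)) ((volume : Measure E3).prod volume) := by
    refine (MeasurePreserving.id (volume : Measure E3)).skew_product (g := fun y t ↦ t + h y) ?_ ?_
    · exact measurable_snd.add (hh.comp measurable_fst)
    · exact Eventually.of_forall fun y ↦ map_add_right_eq_self volume (h y)
  -- conjugated by the swap: the shear on `ℝ × E3`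
  have hs1 : MeasurePreserving (Prod.swap : ℝ × E3 → E3 × ℝ)
      ((volume : Measure ℝ).prod (volume : Measure E3)) ((volume : Measure E3).prod volume) :=
    Measure.measurePreserving_swap
  have hs2 : MeasurePreserving (Prod.swap : E3 × ℝ → ℝ × E3)
      ((volume : Measure E3).prod (volume : Measure ℝ)) ((volume : Measure ℝ).prod volume) :=
    Measure.measurePreserving_swap
  have h2 : MeasurePreserving
      (Prod.swap ∘ (fun p : E3 × ℝ ↦ (p.1, p.2 + h p.1)) ∘ (Prod.swap : ℝ × E3 → E3 × ℝ))
      (volume : Measure (ℝ × E3)) (volume : Measure (ℝ × E3)) := by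
    rw [Measure.volume_eq_prod]
    exact hs2.comp (h1.comp hs1)
  -- conjugated by `timeSplit`
  have key : (fun x : E4 ↦ ofTimeSpace (x 0 + h (spatial x)) (spatial x)) =
      timeSplit.symm ∘
        (Prod.swap ∘ (fun p : E3 × ℝ ↦ (p.1, p.2 + h p.1)) ∘ (Prod.swap : ℝ × E3 → E3 × ℝ)) ∘
          timeSplit := by
    funext x
    simp only [Function.comp_apply, timeSplit_apply, Prod.swap_prod_mk, timeSplit_symm_apply]
  rw [key]
  exact measurePreserving_timeSplit_symm.comp (h2.comp measurePreserving_timeSplit)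

end E4

namespace Kerr

/-! ### The general reparametrisation: leaves over `B`, labels in `S` -/

/-- **Time integrals of leaf integrals are space-time integrals.** For a measurable height
`h : E3 → ℝ`, a measurable `G : E4 → [0, ∞]`, a measurable set `S ⊆ ℝ` of leaf labels and a
measurable `B ⊆ E3`:
`∫_{τ ∈ S} ( ∫_{y ∈ B} G(τ + h(y), y) dy ) dτ = ∫_{{x ∈ E4 | x⃗ ∈ B, x⁰ − h(x⃗) ∈ S}} G(x) dx`,
i.e. the union `⋃_{τ ∈ S} (Σ̃_τ(h) ∩ {y ∈ B})` of leaf parts, parametrised by `(τ, y)`, carries the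
space-time Lebesgue measure (`E4.measurePreserving_leafShear` and Tonelli,
`E4.setLIntegral_timeSlab_eq`). With `dVol = dt* dy` in the Kerr–Schild chart this is the passage
between the leaf-wise quantities of `KerrDecayHierarchy.lean` and the space-time integrals
`∫_{𝓡(τ',τ'')} (…)` of DRSR arXiv:1402.7034, §2.2.5, §2.3.2, §3.3. [folklore] -/
theorem lintegral_lintegral_leafPoint_eq {h : E3 → ℝ} (hh : Measurable h) {G : E4 → ℝ≥0∞}
    (hG : Measurable G) {S : Set ℝ} (hS : MeasurableSet S) {B : Set E3} (hB : MeasurableSet B) :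
    ∫⁻ τ in S, ∫⁻ y in B, G (leafPoint h τ y) =
      ∫⁻ x in {x : E4 | E4.spatial x ∈ B ∧ x 0 - h (E4.spatial x) ∈ S}, G x := by
  -- the shear and the two regions
  set Φ : E4 → E4 := fun x ↦ E4.ofTimeSpace (x 0 + h (E4.spatial x)) (E4.spatial x) with hΦ
  have hmp : MeasurePreserving Φ volume volume := E4.measurePreserving_leafShear hh
  have hsp : Measurable (E4.spatial : E4 → E3) := E4.spatial.continuous.measurable
  have h0 : Measurable fun x : E4 ↦ x 0 := (E4.dx 0).continuous.measurable
  have hBs : MeasurableSet (E4.spatial ⁻¹' B : Set E4) := hsp hB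
  have hA : MeasurableSet {x : E4 | E4.spatial x ∈ B ∧ x 0 - h (E4.spatial x) ∈ S} := by
    change MeasurableSet ((E4.spatial ⁻¹' B) ∩ {x : E4 | x 0 - h (E4.spatial x) ∈ S})
    exact hBs.inter ((h0.sub (hh.comp hsp)) hS)
  have hpre : Φ ⁻¹' {x : E4 | E4.spatial x ∈ B ∧ x 0 - h (E4.spatial x) ∈ S} =
      (E4.spatial ⁻¹' B) ∩ {x : E4 | x 0 ∈ S} := by
    ext x
    simp [hΦ]
  symm
  -- change of variables under the shear, then Tonelli on the slab
  rw [← hmp.setLIntegral_comp_preimage hA hG, hpre, ← Measure.restrict_restrict hBs,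
    ← lintegral_indicator hBs,
    E4.setLIntegral_timeSlab_eq ((E4.spatial ⁻¹' B).indicator fun x ↦ G (Φ x))
      (by exact (hG.comp hmp.measurable).indicator hBs) hS]
  refine lintegral_congr fun τ ↦ ?_
  rw [← lintegral_indicator hB]
  refine lintegral_congr fun y ↦ ?_
  by_cases hy : y ∈ B
  · rw [indicator_of_mem (show E4.ofTimeSpace τ y ∈ E4.spatial ⁻¹' B by simpa using hy),
      indicator_of_mem hy]
    simp [hΦ, leafPoint]
  · rw [indicator_of_notMem (show E4.ofTimeSpace τ y ∉ E4.spatial ⁻¹' B by simpa using hy),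
      indicator_of_notMem hy]

/-! ### The region between two leaves over a ball -/

/-- The **leaf slab** `leafSlab h R s t = {x ∈ E4 | ‖x⃗‖ ≤ R, s + h(x⃗) ≤ x⁰ ≤ t + h(x⃗)}`: the
closed region of the Kerr–Schild chart between the leaves `Σ̃_s(h)` and `Σ̃_t(h)` of the
height-`h` foliation, over the closed coordinate ball of radius `R` — the union of the leaf parts
`Σ̃_τ(h) ∩ {‖y‖ ≤ R}`, `τ ∈ [s, t]`, whose fluxes and masses `Kerr.localLeafFlux`,
`Kerr.localLeafMass` are integrated in `Kerr.localError`. For the leaves of DRSR's foliations this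
is `𝓡(s, t) ∩ {‖y‖ ≤ R} = D⁺(Σ̃_s) ∩ J⁻(Σ̃_t) ∩ {‖y‖ ≤ R}` (arXiv:1402.7034, §2.2.5 with §3.3).
[cite: DafermosRodnianskiShlapentokhrothman2014, §2.2.5, §3.3] -/
def leafSlab (h : E3 → ℝ) (R s t : ℝ) : Set E4 :=
  {x : E4 | E4.spatialNorm x ≤ R ∧ s + h (E4.spatial x) ≤ x 0 ∧ x 0 ≤ t + h (E4.spatial x)}

/-- Membership in the leaf slab. [folklore] -/
theorem mem_leafSlab {h : E3 → ℝ} {R s t : ℝ} {x : E4} :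
    x ∈ leafSlab h R s t ↔
      E4.spatialNorm x ≤ R ∧ s + h (E4.spatial x) ≤ x 0 ∧ x 0 ≤ t + h (E4.spatial x) :=
  Iff.rfl

/-- The leaf slab as a sheared cylinder: `x ∈ leafSlab h R s t ↔ x⃗ ∈ B̄_R ∧ x⁰ − h(x⃗) ∈ [s, t]`
(the form of `Kerr.lintegral_lintegral_leafPoint_eq`). [folklore] -/
theorem leafSlab_eq (h : E3 → ℝ) (R s t : ℝ) :
    leafSlab h R s t =
      {x : E4 | E4.spatial x ∈ closedBall (0 : E3) R ∧ x 0 - h (E4.spatial x) ∈ Icc s t} := by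
  ext x
  simp only [mem_leafSlab, mem_setOf_eq, mem_closedBall_zero_iff, mem_Icc, E4.spatialNorm,
    le_sub_iff_add_le, sub_le_iff_le_add]

/-- The leaf point `(τ + h y, y)` lies in the slab iff `‖y‖ ≤ R` and `τ ∈ [s, t]`: the slab is the
union of the parts over the ball of the leaves `Σ̃_τ(h)`, `s ≤ τ ≤ t`. [folklore] -/
theorem leafPoint_mem_leafSlab_iff {h : E3 → ℝ} {R s t τ : ℝ} {y : E3} :
    leafPoint h τ y ∈ leafSlab h R s t ↔ ‖y‖ ≤ R ∧ τ ∈ Icc s t := by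
  rw [leafSlab_eq]
  simp [leafPoint]

/-- The leaf slab is a measurable set (closed, for continuous `h`). [folklore] -/
theorem measurableSet_leafSlab {h : E3 → ℝ} (hh : Measurable h) (R s t : ℝ) :
    MeasurableSet (leafSlab h R s t) := by
  have hsp : Measurable (E4.spatial : E4 → E3) := E4.spatial.continuous.measurable
  have h0 : Measurable fun x : E4 ↦ x 0 := (E4.dx 0).continuous.measurable
  rw [leafSlab_eq]
  change MeasurableSet ((E4.spatial ⁻¹' closedBall (0 : E3) R) ∩
    {x : E4 | x 0 - h (E4.spatial x) ∈ Icc s t})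
  exact (hsp measurableSet_closedBall).inter ((h0.sub (hh.comp hsp)) measurableSet_Icc)

/-- For a non-negative height, the slab between `Σ̃_s(h)` and `Σ̃_t(h)` lies in `{t* ≥ s}` (so for
`s ≥ 0` in the region `{t* ≥ 0}` where the admissible waves of facts A and B are smooth solutions).
[folklore] -/
theorem le_time_of_mem_leafSlab {h : E3 → ℝ} (hh : ∀ y, 0 ≤ h y) {R s t : ℝ} {x : E4}
    (hx : x ∈ leafSlab h R s t) : s ≤ x 0 :=
  le_trans (le_add_of_nonneg_right (hh _)) hx.2.1

/-- On radii `R ≤ R₁` the leaves `Σ̃_τ(h♯_{R₁})` are the Kerr–Schild slices over the ball, and the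
slab is the coordinate cylinder `{‖x⃗‖ ≤ R, s ≤ x⁰ ≤ t}` (`Kerr.scriHeight_eq_zero_of_norm_le`).
DRSR arXiv:1402.7034, p. 51. [folklore] -/
theorem leafSlab_scriHeight_of_le {M a R R₁ s t : ℝ} (hR₁ : 0 ≤ R₁) (hR : R ≤ R₁) :
    leafSlab (scriHeight M a R₁) R s t = {x : E4 | E4.spatialNorm x ≤ R ∧ s ≤ x 0 ∧ x 0 ≤ t} := by
  ext x
  simp only [mem_leafSlab, mem_setOf_eq]
  constructor
  · rintro ⟨hxR, hs, ht⟩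
    have h0 : scriHeight M a R₁ (E4.spatial x) = 0 :=
      scriHeight_eq_zero_of_norm_le hR₁ (hxR.trans hR)
    rw [h0, add_zero] at hs ht
    exact ⟨hxR, hs, ht⟩
  · rintro ⟨hxR, hs, ht⟩
    have h0 : scriHeight M a R₁ (E4.spatial x) = 0 :=
      scriHeight_eq_zero_of_norm_le hR₁ (hxR.trans hR)
    rw [h0, add_zero, add_zero]
    exact ⟨hxR, hs, ht⟩

/-! ### Global smoothness of the cut-off heights -/

/-- **The cut-off heights are `C^∞` on all of `E3`.** For `0 ≤ ρ < R₁` and a far slope `σ` that is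
`C^∞` on `(ρ, ∞)`, `cutoffHeight σ a R₁` is smooth everywhere: on the open set `{r(0, ·) > ρ}` by
`Kerr.contDiffOn_cutoffHeight`, and near every other point it vanishes identically
(`Kerr.cutoffHeight_eventuallyEq_zero`, as `r(0, y) ≤ ρ < R₁` there). DRSR arXiv:1402.7034, p. 51
(the leaves are smooth hypersurfaces). [folklore] -/
theorem contDiff_cutoffHeight {σ : ℝ → ℝ} {a ρ R₁ : ℝ} (hρ : 0 ≤ ρ)
    (hσ : ContDiffOn ℝ ∞ σ (Ioi ρ)) (hR : ρ < R₁) : ContDiff ℝ ∞ (cutoffHeight σ a R₁) := by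
  refine contDiff_iff_contDiffAt.2 fun y ↦ ?_
  by_cases hy : ρ < radius a (E4.ofTimeSpace 0 y)
  · have hopen : IsOpen {y : E3 | ρ < radius a (E4.ofTimeSpace 0 y)} :=
      isOpen_lt continuous_const ((continuous_radius a).comp (E4.continuous_ofTimeSpace 0))
    exact (contDiffOn_cutoffHeight hρ hσ hR).contDiffAt (hopen.mem_nhds hy)
  · have hlt : radius a (E4.ofTimeSpace 0 y) < R₁ := (not_lt.mp hy).trans_lt hR
    exact (contDiffAt_const (c := (0 : ℝ))).congr_of_eventuallyEq
      (cutoffHeight_eventuallyEq_zero (hρ.trans hR.le) hlt)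

/-- **`h♯_{R₁}` is `C^∞` on `E3`** for `|a| < M` and `R₁ > r₊` (the case `σ = scriSlope M a`,
`ρ = r₊` of `Kerr.contDiff_cutoffHeight`; `Kerr.contDiffOn_scriSlope`). DRSR arXiv:1402.7034, §3.3
and p. 51. [folklore] -/
theorem contDiff_scriHeight {M a R₁ : ℝ} (h : IsSubextremal M a) (hRp : rPlus M a < R₁) :
    ContDiff ℝ ∞ (scriHeight M a R₁) := by
  rw [scriHeight_eq_cutoffHeight]
  exact contDiff_cutoffHeight h.rPlus_pos.le (contDiffOn_scriSlope h) hRp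

/-! ### Continuity of the flux density `T[ψ](V, W_h)` on the exterior chart -/

/-- `x ↦ ℓ♯(x)` is continuous on a chart domain (its components are `∓ℓ_μ`, continuous on
`{r > 0}`). [folklore] -/
theorem continuous_nullVector_restrict (a r₀ : ℝ) :
    Continuous fun x : region a r₀ ↦ nullVector a x.1 := by
  unfold nullVector
  refine (PiLp.continuous_toLp 2 _).comp (continuous_pi fun μ ↦ ?_)
  by_cases hμ : μ = 0
  · simp only [hμ, if_true]
    exact (continuous_nullCovectorFun_restrict a r₀ 0).neg
  · simp only [hμ, if_false]
    exact continuous_nullCovectorFun_restrict a r₀ μ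

/-- `x ↦ V(x) = ∂_{t*} − 2H ℓ♯` is continuous on a chart domain. [folklore] -/
theorem continuous_timeVector_restrict (M a r₀ : ℝ) :
    Continuous fun x : region a r₀ ↦ timeVector M a x.1 := by
  unfold timeVector
  exact continuous_const.sub
    ((continuous_const.mul (continuous_scalarH_restrict M a r₀)).smul
      (continuous_nullVector_restrict a r₀))

/-- **`x ↦ dψ_x(Z(x))` is continuous** for a smooth `ψ` on a chart domain and a continuous vector
field `Z` along it (`dψ_x(Z) = ∑_μ Z^μ ∂_μψ̃`, `Kerr.continuous_dcov_apply`). [folklore] -/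
theorem continuous_dcov_apply_of_continuous {a r₀ : ℝ} {ψ : region a r₀ → ℝ}
    (hψ : ContMDiff 𝓘(ℝ, E4) 𝓘(ℝ, ℝ) ∞ ψ) {Z : region a r₀ → E4} (hZ : Continuous Z) :
    Continuous fun x : region a r₀ ↦ dcov ψ x (Z x) := by
  have heq : (fun x : region a r₀ ↦ dcov ψ x (Z x)) =
      fun x ↦ ∑ μ : Fin 4, (Z x) μ * dcov ψ x (E4.basisVector μ) := by
    funext x
    exact E4.linearMap_apply_eq_sum _ _
  rw [heq]
  refine continuous_finsetSum _ fun μ _ ↦ ?_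
  exact ((E4.dx μ).continuous.comp hZ).mul (continuous_dcov_apply hψ _)

/-- For a `C¹` height `h`, `x ↦ ν_x(Z(x)) = Z⁰ − dh_{x⃗}(Z⃗)` is continuous along any continuous vector
field `Z` on the exterior chart (`Kerr.leafConormal_apply`). [folklore] -/
theorem continuous_leafConormal_apply {M a : ℝ} {h : E3 → ℝ} (hh : ContDiff ℝ 1 h)
    {Z : region a (rPlus M a) → E4} (hZ : Continuous Z) :
    Continuous fun x : region a (rPlus M a) ↦ leafConormal h x.1 (Z x) := by
  simp only [leafConormal_apply]
  refine ((E4.dx 0).continuous.comp hZ).sub ?_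
  exact ((hh.continuous_fderiv one_ne_zero).comp
    (E4.spatial.continuous.comp continuous_subtype_val)).clm_apply (E4.spatial.continuous.comp hZ)

/-- **The leaf normal `W_h = −g♯ d(t* − h)` is continuous** on the exterior chart for a `C¹` height
(`W_h = −(η♯ν − 2H ν(ℓ♯) ℓ♯)`, `ν = dt* − dh`, by `Kerr.sharp_smoothMetric`). [folklore] -/
theorem continuous_leafNormal [Facts] {h : E3 → ℝ} (hh : ContDiff ℝ 1 h) (M a : ℝ) :
    Continuous fun x : region a (rPlus M a) ↦ leafNormal M a h x := by
  have heq : (fun x : region a (rPlus M a) ↦ leafNormal M a h x) =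
      fun x ↦ -(etaSharp (leafConormal h x.1) -
        (2 * scalarH M a x.1 * leafConormal h x.1 (nullVector a x.1)) • nullVector a x.1) := by
    funext x
    rw [leafNormal, sharp_smoothMetric]
    rfl
  rw [heq]
  have hη : Continuous fun x : region a (rPlus M a) ↦ etaSharp (leafConormal h x.1) := by
    unfold etaSharp
    refine (PiLp.continuous_toLp 2 _).comp (continuous_pi fun μ ↦ ?_)
    by_cases hμ : μ = 0
    · simp only [hμ, if_true]
      exact (continuous_leafConormal_apply (M := M) hh continuous_const).neg
    · simp only [hμ, if_false]
      exact continuous_leafConormal_apply (M := M) hh continuous_const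
  have hl := continuous_nullVector_restrict a (rPlus M a)
  have hH := continuous_scalarH_restrict M a (rPlus M a)
  exact (hη.sub (((continuous_const.mul hH).mul
    (continuous_leafConormal_apply (M := M) hh hl)).smul hl)).neg

/-- **The flux density `x ↦ T[ψ](V, W_h)(x)` through the leaves of a `C¹` height is continuous** on
the exterior chart, for smooth `ψ` (`T(V, W) = dψ(V) dψ(W) − ½ g⁻¹(dψ, dψ) g(V, W)` with
`g(V, W) = −ν(V)`, `Kerr.bilin_timeVector_leafNormal`, and the explicit `Kerr.gradSq_smoothMetric`).
This is the continuity behind the measurability of the space-time flux density; cf.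
`Kerr.continuous_stressEnergy_timeVector` (the case `h = 0`). [folklore] -/
theorem continuous_stressEnergy_timeVector_leafNormal [Facts] (M a : ℝ) {h : E3 → ℝ}
    (hh : ContDiff ℝ 1 h) {ψ : region a (rPlus M a) → ℝ}
    (hψ : ContMDiff 𝓘(ℝ, E4) 𝓘(ℝ, ℝ) ∞ ψ) :
    Continuous fun x : region a (rPlus M a) ↦
      (smoothMetric M a (rPlus M a)).stressEnergy ψ x (timeVector M a x.1)
        (leafNormal M a h x) := by
  have hV := continuous_timeVector_restrict M a (rPlus M a)
  have hW := continuous_leafNormal hh M a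
  have h1 : Continuous fun x : region a (rPlus M a) ↦ dcov ψ x (timeVector M a x.1) :=
    continuous_dcov_apply_of_continuous hψ hV
  have h2 : Continuous fun x : region a (rPlus M a) ↦ dcov ψ x (leafNormal M a h x) :=
    continuous_dcov_apply_of_continuous hψ hW
  have h3 : Continuous fun x : region a (rPlus M a) ↦ (smoothMetric M a (rPlus M a)).gradSq ψ x := by
    simp only [gradSq_smoothMetric]
    have hd := fun μ ↦ continuous_dcov_apply hψ (E4.basisVector μ)
    have hl : Continuous fun x : region a (rPlus M a) ↦ dcov ψ x (nullVector a x.1) :=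
      continuous_dcov_apply_of_continuous hψ (continuous_nullVector_restrict a (rPlus M a))
    have hH := continuous_scalarH_restrict M a (rPlus M a)
    have hd0 := hd 0
    have hd1 := hd 1
    have hd2 := hd 2
    have hd3 := hd 3
    fun_prop
  have h4 : Continuous fun x : region a (rPlus M a) ↦
      (smoothMetric M a (rPlus M a)).val x (timeVector M a x.1) (leafNormal M a h x) := by
    have : (fun x : region a (rPlus M a) ↦
        (smoothMetric M a (rPlus M a)).val x (timeVector M a x.1) (leafNormal M a h x)) =
        fun x ↦ -leafConormal h x.1 (timeVector M a x.1) := by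
      funext x
      rw [smoothMetric_val]
      exact bilin_timeVector_leafNormal M a h x
    rw [this]
    exact (continuous_leafConormal_apply (M := M) hh hV).neg
  simp only [PseudoRiemannianMetric.stressEnergy_apply, mvfderiv_apply_eq_dcov]
  exact (h1.mul h2).sub ((h3.div_const 2).mul h4)

/-! ### The flux and mass densities as functions on space-time -/

open scoped Classical in
/-- The **space-time flux density** `1_{r > r₊}(x) · T[ψ](V, W_h)(x)` of the height-`h` foliation, as
an extended non-negative real function on `E4` (`0` off the exterior chart): the function whose
value at the leaf point `(τ + h y, y)` is `Kerr.leafFluxDensity M a h ψ τ y`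
(`Kerr.leafFluxDensity_eq_spacetimeFluxDensity`). DRSR arXiv:1402.7034, §3.1, §3.3 (the densities
`J^V_μ[ψ] n^μ_{Σ̃_τ}`). [cite: DafermosRodnianskiShlapentokhrothman2014, §3.3] -/
def spacetimeFluxDensity [Facts] (M a : ℝ) (h : E3 → ℝ) (ψ : region a (rPlus M a) → ℝ) (x : E4) :
    ℝ≥0∞ :=
  if hx : x ∈ region a (rPlus M a) then
    ENNReal.ofReal ((smoothMetric M a (rPlus M a)).stressEnergy ψ ⟨x, hx⟩ (timeVector M a x)
      (leafNormal M a h ⟨x, hx⟩))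
  else 0

open scoped Classical in
/-- The **space-time mass density** `1_{r > r₊}(x) · ψ(x)²` as an extended non-negative real function
on `E4`: the function whose value at the leaf point `(τ + h y, y)` is `Kerr.leafMassDensity M a h ψ τ y`
(`Kerr.leafMassDensity_eq_spacetimeMassDensity`); the integrand of the zeroth-order member
`∫ r^{-3-δ} ψ²` of DRSR (20) and of the error terms `∫ r^{p−2} φ²` of the `r^p` hierarchy
(arXiv:1509.08489, Thm. 5.1), without the weights. [cite: DafermosRodnianskiShlapentokhrothman2014, Thm. 3.1 (20)] -/
def spacetimeMassDensity (M a : ℝ) (ψ : region a (rPlus M a) → ℝ) (x : E4) : ℝ≥0∞ :=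
  if hx : x ∈ region a (rPlus M a) then ENNReal.ofReal (ψ ⟨x, hx⟩ ^ 2) else 0

/-- The leaf flux density over `y` is the space-time flux density at the leaf point (definitional).
[folklore] -/
theorem leafFluxDensity_eq_spacetimeFluxDensity [Facts] (M a : ℝ) (h : E3 → ℝ)
    (ψ : region a (rPlus M a) → ℝ) (τ : ℝ) (y : E3) :
    leafFluxDensity M a h ψ τ y = spacetimeFluxDensity M a h ψ (leafPoint h τ y) :=
  rfl

/-- The leaf mass density over `y` is the space-time mass density at the leaf point (definitional).
[folklore] -/
theorem leafMassDensity_eq_spacetimeMassDensity (M a : ℝ) (h : E3 → ℝ)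
    (ψ : region a (rPlus M a) → ℝ) (τ : ℝ) (y : E3) :
    leafMassDensity M a h ψ τ y = spacetimeMassDensity M a ψ (leafPoint h τ y) :=
  rfl

/-- Off the exterior chart the space-time flux density vanishes. [folklore] -/
theorem spacetimeFluxDensity_of_not_mem [Facts] {M a : ℝ} (h : E3 → ℝ) (ψ : region a (rPlus M a) → ℝ)
    {x : E4} (hx : x ∉ region a (rPlus M a)) : spacetimeFluxDensity M a h ψ x = 0 := by
  simp [spacetimeFluxDensity, hx]

/-- On the exterior chart the space-time flux density is `T[ψ](V, W_h)` (truncated at `0` by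
`ENNReal.ofReal`; for the leaves `Σ̃_τ(h♯_{R₁})`, `R₁ > 2M`, nothing is truncated,
`Kerr.stressEnergy_timeVector_leafNormal_scriHeight_nonneg`). [folklore] -/
theorem spacetimeFluxDensity_of_mem [Facts] {M a : ℝ} (h : E3 → ℝ) (ψ : region a (rPlus M a) → ℝ)
    {x : E4} (hx : x ∈ region a (rPlus M a)) :
    spacetimeFluxDensity M a h ψ x =
      ENNReal.ofReal ((smoothMetric M a (rPlus M a)).stressEnergy ψ ⟨x, hx⟩ (timeVector M a x)
        (leafNormal M a h ⟨x, hx⟩)) := by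
  simp [spacetimeFluxDensity, hx]

/-- Off the exterior chart the space-time mass density vanishes. [folklore] -/
theorem spacetimeMassDensity_of_not_mem {M a : ℝ} (ψ : region a (rPlus M a) → ℝ) {x : E4}
    (hx : x ∉ region a (rPlus M a)) : spacetimeMassDensity M a ψ x = 0 := by
  simp [spacetimeMassDensity, hx]

/-- On the exterior chart the space-time mass density is `ψ²`. [folklore] -/
theorem spacetimeMassDensity_of_mem {M a : ℝ} (ψ : region a (rPlus M a) → ℝ) {x : E4}
    (hx : x ∈ region a (rPlus M a)) :
    spacetimeMassDensity M a ψ x = ENNReal.ofReal (ψ ⟨x, hx⟩ ^ 2) := by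
  simp [spacetimeMassDensity, hx]

/-- **The space-time flux density is measurable** for a `C¹` height and a smooth `ψ` (continuous on
the open exterior chart, `Kerr.continuous_stressEnergy_timeVector_leafNormal`, zero outside).
[folklore] -/
theorem measurable_spacetimeFluxDensity [Facts] (M a : ℝ) {h : E3 → ℝ} (hh : ContDiff ℝ 1 h)
    {ψ : region a (rPlus M a) → ℝ} (hψ : ContMDiff 𝓘(ℝ, E4) 𝓘(ℝ, ℝ) ∞ ψ) :
    Measurable (spacetimeFluxDensity M a h ψ) := by
  classical
  unfold spacetimeFluxDensity
  refine Measurable.dite (f := fun x : (region a (rPlus M a) : Set E4) ↦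
      ENNReal.ofReal ((smoothMetric M a (rPlus M a)).stressEnergy ψ x (timeVector M a x.1)
        (leafNormal M a h x))) ?_ measurable_const (region a (rPlus M a)).2.measurableSet
  exact (ENNReal.continuous_ofReal.comp
    (continuous_stressEnergy_timeVector_leafNormal M a hh hψ)).measurable

/-- **The space-time mass density is measurable** for a continuous `ψ`. [folklore] -/
theorem measurable_spacetimeMassDensity (M a : ℝ) {ψ : region a (rPlus M a) → ℝ}
    (hψ : Continuous ψ) : Measurable (spacetimeMassDensity M a ψ) := by
  classical
  unfold spacetimeMassDensity
  refine Measurable.dite (f := fun x : (region a (rPlus M a) : Set E4) ↦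
      ENNReal.ofReal (ψ x ^ 2)) ?_ measurable_const (region a (rPlus M a)).2.measurableSet
  exact (ENNReal.continuous_ofReal.comp (hψ.pow 2)).measurable

/-! ### The time-integrated leaf functionals as space-time integrals -/

/-- **`∫_{τ ∈ S} localLeafFlux(τ, R) dτ` is a space-time integral**: for a `C¹` height `h`, a smooth
`ψ`, any radius `R` and any measurable set `S` of leaf labels,
`∫_{τ ∈ S} ∫_{‖y‖ ≤ R} J^V_μ[ψ] n^μ_{Σ̃_τ(h)} dy dτ = ∫_{{‖x⃗‖ ≤ R, x⁰ − h(x⃗) ∈ S}} 1_{r>r₊} T[ψ](V, W_h) dVol`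
(`Kerr.lintegral_lintegral_leafPoint_eq` for the measurable density
`Kerr.spacetimeFluxDensity`). DRSR arXiv:1402.7034, §2.3.2, §3.3. [folklore] -/
theorem setLIntegral_localLeafFlux_eq [Facts] {M a : ℝ} {h : E3 → ℝ} (hh : ContDiff ℝ 1 h)
    {ψ : region a (rPlus M a) → ℝ} (hψ : ContMDiff 𝓘(ℝ, E4) 𝓘(ℝ, ℝ) ∞ ψ) (R : ℝ) {S : Set ℝ}
    (hS : MeasurableSet S) :
    ∫⁻ τ in S, localLeafFlux M a h ψ τ R =
      ∫⁻ x in {x : E4 | E4.spatial x ∈ closedBall (0 : E3) R ∧ x 0 - h (E4.spatial x) ∈ S},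
        spacetimeFluxDensity M a h ψ x := by
  simp only [localLeafFlux, leafFluxDensity_eq_spacetimeFluxDensity]
  exact lintegral_lintegral_leafPoint_eq hh.continuous.measurable
    (measurable_spacetimeFluxDensity M a hh hψ) hS measurableSet_closedBall

/-- **`∫_{τ ∈ S} localLeafMass(τ, R) dτ` is a space-time integral**: for a measurable height `h` and a
continuous `ψ`,
`∫_{τ ∈ S} ∫_{‖y‖ ≤ R} ψ(τ + h y, y)² dy dτ = ∫_{{‖x⃗‖ ≤ R, x⁰ − h(x⃗) ∈ S}} 1_{r>r₊} ψ² dVol`.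
DRSR arXiv:1402.7034, Thm. 3.1 (20) (the zeroth-order space-time integral). [folklore] -/
theorem setLIntegral_localLeafMass_eq {M a : ℝ} {h : E3 → ℝ} (hh : Measurable h)
    {ψ : region a (rPlus M a) → ℝ} (hψ : Continuous ψ) (R : ℝ) {S : Set ℝ}
    (hS : MeasurableSet S) :
    ∫⁻ τ in S, localLeafMass M a h ψ τ R =
      ∫⁻ x in {x : E4 | E4.spatial x ∈ closedBall (0 : E3) R ∧ x 0 - h (E4.spatial x) ∈ S},
        spacetimeMassDensity M a ψ x := by
  simp only [localLeafMass, leafMassDensity_eq_spacetimeMassDensity]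
  exact lintegral_lintegral_leafPoint_eq hh (measurable_spacetimeMassDensity M a hψ) hS
    measurableSet_closedBall

/-- **(A4)'s left-hand side as a space-time integral over the leaf slab**:
`∫_{[s,t]} localLeafFlux(τ, R) dτ = ∫_{leafSlab h R s t} 1_{r>r₊} T[ψ](V, W_h) dVol`, for a `C¹` height
and a smooth `ψ`. DRSR arXiv:1402.7034, Thm. 3.2 (25) (left-hand side `∫_{D⁺(Σ̃₀)} …`), §3.3.
[folklore] -/
theorem lintegral_localLeafFlux_eq_setLIntegral [Facts] {M a : ℝ} {h : E3 → ℝ} (hh : ContDiff ℝ 1 h)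
    {ψ : region a (rPlus M a) → ℝ} (hψ : ContMDiff 𝓘(ℝ, E4) 𝓘(ℝ, ℝ) ∞ ψ) (R s t : ℝ) :
    ∫⁻ τ in Icc s t, localLeafFlux M a h ψ τ R =
      ∫⁻ x in leafSlab h R s t, spacetimeFluxDensity M a h ψ x := by
  rw [leafSlab_eq, setLIntegral_localLeafFlux_eq hh hψ R measurableSet_Icc]

/-- **(A8)'s left-hand side as a space-time integral over the leaf slab**:
`∫_{[s,t]} localLeafMass(τ, R) dτ = ∫_{leafSlab h R s t} 1_{r>r₊} ψ² dVol`, for a measurable height and a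
continuous `ψ`. DRSR arXiv:1402.7034, Thm. 3.1 (20) (the member `∫_{D⁺(Σ̃₀)} r^{-3-δ}(ψ − ψ_∞)²`), §3.3.
[folklore] -/
theorem lintegral_localLeafMass_eq_setLIntegral {M a : ℝ} {h : E3 → ℝ} (hh : Measurable h)
    {ψ : region a (rPlus M a) → ℝ} (hψ : Continuous ψ) (R s t : ℝ) :
    ∫⁻ τ in Icc s t, localLeafMass M a h ψ τ R =
      ∫⁻ x in leafSlab h R s t, spacetimeMassDensity M a ψ x := by
  rw [leafSlab_eq, setLIntegral_localLeafMass_eq hh hψ R measurableSet_Icc]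

/-- **The local space-time error functional of fact B is the printed space-time integral**:
`localError … ψ R s t = ∫_{leafSlab h R s t} 1_{r>r₊} (T[ψ](V, W_h) + ψ²) dVol` for a `C¹` height and a
smooth `ψ` — the shape `∫_{𝓡(τ₁,τ₂) ∩ {r ∼ R}} (|∂φ|² + |φ|²)` of the error terms of the `r^p`
hierarchy (Moschidis, arXiv:1509.08489, Thm. 5.1; Dafermos–Rodnianski, arXiv:0910.4957, §3–§4),
as asserted in the docstring of `Kerr.localError`. [cite: Moschidis2016, Thm. 5.1 (right-hand side)] -/
theorem localError_eq_setLIntegral [Facts] {M a : ℝ} {h : E3 → ℝ} (hh : ContDiff ℝ 1 h)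
    {ψ : region a (rPlus M a) → ℝ} (hψ : ContMDiff 𝓘(ℝ, E4) 𝓘(ℝ, ℝ) ∞ ψ) (R s t : ℝ) :
    localError M a h ψ R s t =
      ∫⁻ x in leafSlab h R s t, (spacetimeFluxDensity M a h ψ x + spacetimeMassDensity M a ψ x) := by
  rw [localError, lintegral_localLeafFlux_eq_setLIntegral hh hψ,
    lintegral_localLeafMass_eq_setLIntegral hh.continuous.measurable hψ.continuous,
    ← lintegral_add_left (measurable_spacetimeFluxDensity M a hh hψ)]

/-! ### The leaves `Σ̃_τ(h♯_{R₁})` and the admissible waves of facts A and B -/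

/-- (A4) for the foliation of facts A and B, left-hand side: for `|a| < M`, `R₁ > r₊` and an
admissible wave `ψ`, `∫_{[s,t]} localLeafFlux(τ, R) dτ` through the leaves `Σ̃_τ(h♯_{R₁})` is the
space-time integral of `1_{r>r₊} T[ψ](V, W_{h♯})` over `leafSlab h♯_{R₁} R s t`. DRSR arXiv:1402.7034,
Thm. 3.2 (25) with §3.3. [cite: DafermosRodnianskiShlapentokhrothman2014, Thm. 3.2 (25), §3.3] -/
theorem lintegral_localLeafFlux_scriHeight_eq_setLIntegral [Facts] [SliceFacts] {M a R₁ : ℝ}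
    (hMa : IsSubextremal M a) (hR₁ : rPlus M a < R₁) {ψ : region a (rPlus M a) → ℝ}
    (hψ : Literature.Geometry.Lorentzian.IsAdmissibleKerrWave M a ψ) (R s t : ℝ) :
    ∫⁻ τ in Icc s t, localLeafFlux M a (scriHeight M a R₁) ψ τ R =
      ∫⁻ x in leafSlab (scriHeight M a R₁) R s t, spacetimeFluxDensity M a (scriHeight M a R₁) ψ x :=
  lintegral_localLeafFlux_eq_setLIntegral
    ((contDiff_scriHeight hMa hR₁).of_le (by exact_mod_cast le_top)) hψ.1 R s t

/-- (A8) for the foliation of facts A and B, left-hand side: `∫_{[s,t]} localLeafMass(τ, R) dτ` along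
the leaves `Σ̃_τ(h♯_{R₁})` of an admissible wave is the space-time integral of `1_{r>r₊} ψ²` over
`leafSlab h♯_{R₁} R s t`. DRSR arXiv:1402.7034, Thm. 3.1 (20) with §3.3.
[cite: DafermosRodnianskiShlapentokhrothman2014, Thm. 3.1 (20), §3.3] -/
theorem lintegral_localLeafMass_scriHeight_eq_setLIntegral [Facts] [SliceFacts] {M a R₁ : ℝ}
    (hMa : IsSubextremal M a) (hR₁ : rPlus M a < R₁) {ψ : region a (rPlus M a) → ℝ}
    (hψ : Literature.Geometry.Lorentzian.IsAdmissibleKerrWave M a ψ) (R s t : ℝ) :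
    ∫⁻ τ in Icc s t, localLeafMass M a (scriHeight M a R₁) ψ τ R =
      ∫⁻ x in leafSlab (scriHeight M a R₁) R s t, spacetimeMassDensity M a ψ x :=
  lintegral_localLeafMass_eq_setLIntegral (contDiff_scriHeight hMa hR₁).continuous.measurable
    hψ.1.continuous R s t

/-- **The error functional `localError` of fact B, for the foliation `Σ̃_τ(h♯_{R₁})` and an admissible
wave, is the space-time integral of `1_{r>r₊} (T[ψ](V, W_{h♯}) + ψ²)` over the slab between
`Σ̃_s(h♯_{R₁})` and `Σ̃_t(h♯_{R₁})` over the ball `{‖y‖ ≤ R}`** — the printed shape of the error terms of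
the `r^p` estimates (B1)–(B3) (Moschidis arXiv:1509.08489, Thm. 5.1) and of the left-hand sides of
DRSR (20), (25) restricted to compact regions, which (A4) and (A8) of fact A bound.
[cite: Moschidis2016, Thm. 5.1 (right-hand side); DafermosRodnianskiShlapentokhrothman2014 §3.3] -/
theorem localError_scriHeight_eq_setLIntegral [Facts] [SliceFacts] {M a R₁ : ℝ} (hMa : IsSubextremal M a)
    (hR₁ : rPlus M a < R₁) {ψ : region a (rPlus M a) → ℝ}
    (hψ : Literature.Geometry.Lorentzian.IsAdmissibleKerrWave M a ψ) (R s t : ℝ) :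
    localError M a (scriHeight M a R₁) ψ R s t =
      ∫⁻ x in leafSlab (scriHeight M a R₁) R s t,
        (spacetimeFluxDensity M a (scriHeight M a R₁) ψ x + spacetimeMassDensity M a ψ x) :=
  localError_eq_setLIntegral ((contDiff_scriHeight hMa hR₁).of_le (by exact_mod_cast le_top)) hψ.1
    R s t

/-! ### The flux density through the leaves is dominated by the coordinate energy density

Clause (A4) of fact A asserts, among its identifications, that over the coordinate ball the
leaves `Σ̃_τ(h♯_{R₁})` are uniformly spacelike, "so the flux density is `≤ C(M, a, R₁, R) ∑(∂ψ)²`,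
cf. `Kerr.stressEnergy_timeVector_le_sum_sq_of_isSubextremal` where the leaf is the slice". We
prove this with an absolute constant and no restriction on the radius: at every exterior point,
`T[ψ](V, W_h) ≤ 250 ∑_μ (∂_μψ)²` for every cut-off height `h` with far slope `0 ≤ σ ≤ σ♯`
(`R₁ ≥ 4M`) — the upper companion of the coercivity estimate `Kerr.leafCoercivity_pointwise` of
`KerrLeafCoercivity.lean` (whose elementary range lemmas are re-proved here privately, to keep this
file independent of the pointwise-decay files which that file imports). -/

section UpperComparability

/-- Cauchy–Schwarz in `ℝ³`, by Lagrange's identity: `(k⃗ · p⃗)² ≤ |k⃗|² |p⃗|²`. [folklore] -/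
private theorem dot_sq_le (k₁ k₂ k₃ p₁ p₂ p₃ : ℝ) :
    (k₁ * p₁ + k₂ * p₂ + k₃ * p₃) ^ 2 ≤ (k₁ ^ 2 + k₂ ^ 2 + k₃ ^ 2) * (p₁ ^ 2 + p₂ ^ 2 + p₃ ^ 2) := by
  nlinarith [sq_nonneg (k₁ * p₂ - k₂ * p₁), sq_nonneg (k₁ * p₃ - k₃ * p₁),
    sq_nonneg (k₂ * p₃ - k₃ * p₂)]

/-- `(X − Y)² ≤ 2X² + 2Y²`. [folklore] -/
private theorem sq_sub_le_two (X Y : ℝ) : (X - Y) ^ 2 ≤ 2 * X ^ 2 + 2 * Y ^ 2 := by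
  nlinarith [sq_nonneg (X + Y)]

/-- `(x + y + z)² ≤ 3(x² + y² + z²)`. [folklore] -/
private theorem sq_add_three_le (x y z : ℝ) :
    (x + y + z) ^ 2 ≤ 3 * (x ^ 2 + y ^ 2 + z ^ 2) := by
  nlinarith [sq_nonneg (x - y), sq_nonneg (x - z), sq_nonneg (y - z)]

/-- `AB ≤ ½(A² + B²)`. [folklore] -/
private theorem mul_le_half_sq_add_sq (A B : ℝ) : A * B ≤ (A ^ 2 + B ^ 2) / 2 := by
  nlinarith [sq_nonneg (A - B)]

/-- **The algebra of the upper comparability.** In the notation of `Kerr.leafCoercivity_alg`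
(`KerrLeafCoercivity.lean`): for `0 ≤ H ≤ 1`, `|ℓ⃗| = 1`, `|k⃗|² ≤ 18` and a slope parameter
`0 ≤ kl ≤ 3` (in the application `kl = k⃗·ℓ⃗`), the
flux density `T = T[ψ](V, −g♯ν)` (written out in Kerr–Schild components, `p = dψ = (s, p⃗)`)
satisfies `T ≤ 250 (s² + |p⃗|²)`: with `A = (1 + 2H)s − 2H(ℓ⃗·p⃗)`,
`B = s + k⃗·p⃗ + 2H(1 + kl)(s − ℓ⃗·p⃗)`, `T = AB + ½(1 + 2H(1 + kl))(−s² + |p⃗|² − 2H(ℓ⃗·p⃗ − s)²)`,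
and `AB ≤ ½(A² + B²) ≤ ½(405 s² + 446 |p⃗|²)`, the last term being `≤ (9/2)|p⃗|²`. Elementary; the
upper half of DRSR arXiv:1402.7034, §3.1 (28) (`∫ J^N_μ n^μ ∼ ‖∂ψ‖²`) for the hyperboloidal leaves.
[folklore] -/
theorem leafFluxUpper_alg (H s p₁ p₂ p₃ k₁ k₂ k₃ l₁ l₂ l₃ kl : ℝ) (hH0 : 0 ≤ H) (hH1 : H ≤ 1)
    (hl : l₁ ^ 2 + l₂ ^ 2 + l₃ ^ 2 = 1) (hK : k₁ ^ 2 + k₂ ^ 2 + k₃ ^ 2 ≤ 18) (hkl : 0 ≤ kl)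
    (hkl3 : kl ≤ 3) :
    -((1 + 2 * H) * s - 2 * H * (l₁ * p₁ + l₂ * p₂ + l₃ * p₃)) *
          (-s - (k₁ * p₁ + k₂ * p₂ + k₃ * p₃) -
            2 * H * (1 + kl) * (s - (l₁ * p₁ + l₂ * p₂ + l₃ * p₃))) +
        (1 + 2 * H * (1 + kl)) / 2 *
          (-s ^ 2 + (p₁ ^ 2 + p₂ ^ 2 + p₃ ^ 2) -
            2 * H * (-s + (l₁ * p₁ + l₂ * p₂ + l₃ * p₃)) ^ 2) ≤
      250 * (s ^ 2 + (p₁ ^ 2 + p₂ ^ 2 + p₃ ^ 2)) := by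
  -- `m = ℓ⃗·p⃗`, `kp = k⃗·p⃗`, `P = |p⃗|²`, with `m² ≤ P`, `kp² ≤ 18 P`
  have hm2' : (l₁ * p₁ + l₂ * p₂ + l₃ * p₃) ^ 2 ≤ p₁ ^ 2 + p₂ ^ 2 + p₃ ^ 2 := by
    have h := dot_sq_le l₁ l₂ l₃ p₁ p₂ p₃
    rwa [hl, one_mul] at h
  have hkp2' : (k₁ * p₁ + k₂ * p₂ + k₃ * p₃) ^ 2 ≤ 18 * (p₁ ^ 2 + p₂ ^ 2 + p₃ ^ 2) :=
    (dot_sq_le k₁ k₂ k₃ p₁ p₂ p₃).trans (mul_le_mul_of_nonneg_right hK (by positivity))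
  have hP0' : 0 ≤ p₁ ^ 2 + p₂ ^ 2 + p₃ ^ 2 := by positivity
  obtain ⟨m, hm⟩ : ∃ m, l₁ * p₁ + l₂ * p₂ + l₃ * p₃ = m := ⟨_, rfl⟩
  obtain ⟨kp, hkp⟩ : ∃ kp, k₁ * p₁ + k₂ * p₂ + k₃ * p₃ = kp := ⟨_, rfl⟩
  obtain ⟨P, hP⟩ : ∃ P, p₁ ^ 2 + p₂ ^ 2 + p₃ ^ 2 = P := ⟨_, rfl⟩
  rw [hm, hP] at hm2'
  rw [hkp, hP] at hkp2'
  rw [hP] at hP0'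
  rw [hm, hkp, hP]
  -- `d = 2H(1 + kl) ∈ [0, 8]`
  have hd0 : 0 ≤ 2 * H * (1 + kl) := by positivity
  have hd8 : 2 * H * (1 + kl) ≤ 8 := by
    have : H * (1 + kl) ≤ 1 * 4 := mul_le_mul hH1 (by linarith) (by linarith) zero_le_one
    linarith
  -- `A² ≤ 18 s² + 8 P`
  have hA2 : ((1 + 2 * H) * s - 2 * H * m) ^ 2 ≤ 18 * s ^ 2 + 8 * P := by
    have h1 := sq_sub_le_two ((1 + 2 * H) * s) (2 * H * m)
    have h2 : ((1 + 2 * H) * s) ^ 2 ≤ 9 * s ^ 2 := by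
      have h9 : (1 + 2 * H) ^ 2 ≤ 9 := by nlinarith
      rw [mul_pow]
      exact mul_le_mul_of_nonneg_right h9 (sq_nonneg s)
    have h3 : (2 * H * m) ^ 2 ≤ 4 * P := by
      have h4 : (2 * H) ^ 2 ≤ 4 := by nlinarith
      rw [mul_pow]
      exact (mul_le_mul_of_nonneg_right h4 (sq_nonneg m)).trans (by linarith)
    linarith
  -- `B² ≤ 387 s² + 438 P`
  have hB2 : (s + kp + 2 * H * (1 + kl) * (s - m)) ^ 2 ≤ 387 * s ^ 2 + 438 * P := by
    have h1 := sq_add_three_le s kp (2 * H * (1 + kl) * (s - m))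
    have h2 : (s - m) ^ 2 ≤ 2 * s ^ 2 + 2 * P := (sq_sub_le_two s m).trans (by linarith)
    have hd2 : (2 * H * (1 + kl)) ^ 2 ≤ 64 := by
      have := pow_le_pow_left₀ hd0 hd8 2
      linarith [show (8 : ℝ) ^ 2 = 64 by norm_num]
    have h3 : (2 * H * (1 + kl) * (s - m)) ^ 2 ≤ 64 * (2 * s ^ 2 + 2 * P) :=
      calc (2 * H * (1 + kl) * (s - m)) ^ 2 = (2 * H * (1 + kl)) ^ 2 * (s - m) ^ 2 := by ring
        _ ≤ 64 * (s - m) ^ 2 := mul_le_mul_of_nonneg_right hd2 (sq_nonneg _)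
        _ ≤ 64 * (2 * s ^ 2 + 2 * P) := mul_le_mul_of_nonneg_left h2 (by norm_num)
    linarith
  have hAB := mul_le_half_sq_add_sq ((1 + 2 * H) * s - 2 * H * m)
    (s + kp + 2 * H * (1 + kl) * (s - m))
  -- the last term is `≤ (9/2) P`
  have hlast : (1 + 2 * H * (1 + kl)) / 2 * (-s ^ 2 + P - 2 * H * (-s + m) ^ 2) ≤ 9 / 2 * P := by
    have h1 : -s ^ 2 + P - 2 * H * (-s + m) ^ 2 ≤ P := by
      nlinarith [sq_nonneg s, mul_nonneg hH0 (sq_nonneg (-s + m))]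
    have h2 := mul_le_mul_of_nonneg_left h1 (by positivity : (0 : ℝ) ≤ (1 + 2 * H * (1 + kl)) / 2)
    have h3 : (1 + 2 * H * (1 + kl)) / 2 * P ≤ 9 / 2 * P :=
      mul_le_mul_of_nonneg_right (by linarith) hP0'
    linarith
  -- assemble: `−A · (−B) = A · B`
  have hT : -((1 + 2 * H) * s - 2 * H * m) * (-s - kp - 2 * H * (1 + kl) * (s - m)) =
      ((1 + 2 * H) * s - 2 * H * m) * (s + kp + 2 * H * (1 + kl) * (s - m)) := by ring
  rw [hT]
  linarith [sq_nonneg s]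

/-- `σ♯(r) < 3` for `r ≥ 4M` (copy of `Kerr.scriSlope_lt_three` of `KerrLeafCoercivity.lean`).
[folklore] -/
private theorem scriSlope_lt_three' {M a r : ℝ} (h : IsSubextremal M a) (hr : 4 * M ≤ r) :
    scriSlope M a r < 3 := by
  have hM := h.pos
  have hr0 : 0 < r := by linarith
  have ha : a ^ 2 < M ^ 2 := h.sq_lt_sq
  have hD : (r - rPlus M a) * (r - rMinus M a) = r ^ 2 - 2 * M * r + a ^ 2 :=
    sub_rPlus_mul_sub_rMinus ha.le r
  unfold scriSlope
  rw [hD]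
  have hΔ : r ^ 2 / 2 ≤ r ^ 2 - 2 * M * r + a ^ 2 := by nlinarith [sq_nonneg a]
  have hΔpos : 0 < r ^ 2 - 2 * M * r + a ^ 2 := by
    have : 0 < r ^ 2 / 2 := by positivity
    linarith
  have hM2 : M ^ 2 ≤ r ^ 2 / 16 := by nlinarith
  have h1 : (r ^ 2 + a ^ 2) / (r ^ 2 - 2 * M * r + a ^ 2) ≤ 9 / 4 := by
    rw [div_le_iff₀ hΔpos]; nlinarith
  have h2 : 2 * M / r ≤ 1 / 2 := by
    rw [div_le_iff₀ hr0]; linarith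
  linarith

/-- `|∇r|² = (r² + a²)/Σ ≤ 2` on the exterior slice (copy of `Kerr.sq_add_sq_div_blSigma_le_two`).
[folklore] -/
private theorem sq_add_sq_div_blSigma_le_two' {M a : ℝ} (h : IsSubextremal M a) {y : E3}
    (hy : rPlus M a < radius a (E4.ofTimeSpace 0 y)) :
    (radius a (E4.ofTimeSpace 0 y) ^ 2 + a ^ 2) / blSigma a y ≤ 2 := by
  have hMr : M < radius a (E4.ofTimeSpace 0 y) := h.M_lt_rPlus.trans hy
  have hr0 : 0 < radius a (E4.ofTimeSpace 0 y) := h.pos.trans hMr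
  have hS := blSigma_pos hr0
  have hSr := sq_le_blSigma hr0
  have ha : a ^ 2 < M ^ 2 := h.sq_lt_sq
  rw [div_le_iff₀ hS]
  nlinarith [h.pos]

/-- `H = Mr/Σ ≤ 1` on the exterior (copy of `Kerr.scalarH_ofTimeSpace_le_one`). [folklore] -/
private theorem scalarH_ofTimeSpace_le_one' {M a : ℝ} (h : IsSubextremal M a) (t : ℝ) {y : E3}
    (hy : rPlus M a < radius a (E4.ofTimeSpace 0 y)) : scalarH M a (E4.ofTimeSpace t y) ≤ 1 := by
  have hMr : M < radius a (E4.ofTimeSpace 0 y) := h.M_lt_rPlus.trans hy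
  have hr0 : 0 < radius a (E4.ofTimeSpace 0 y) := h.pos.trans hMr
  have hS := blSigma_pos hr0
  have hSr := sq_le_blSigma hr0
  rw [scalarH_ofTimeSpace_eq t hr0, div_le_one hS]
  nlinarith [h.pos]

variable [Facts]

/-- **Upper comparability of the leaf flux density (core form).** For `|a| < M`, at an exterior
point `x = (t, y)`, let `hgt` be a height function with radial differential `dh_y = c · dr`,
`0 ≤ c ≤ 3`. Then for every scalar field `ψ`, with `p_μ = dψ_x(∂_μ)` and `W = −g♯d(t* − hgt)`,
`T[ψ](V, W)(x) ≤ 250 ∑_μ p_μ²` (`Kerr.leafFluxUpper_alg` with `H = Mr/Σ ≤ 1`, `|ℓ⃗| = 1`,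
`|k⃗|² = c²(r² + a²)/Σ ≤ 18`, `kl = c`). DRSR arXiv:1402.7034, §3.1 (28), §3.3 (upper half of the
comparability `∫ J^N_μ n^μ ∼ ‖∂ψ‖²` on spacelike leaves). [cite: DafermosRodnianskiShlapentokhrothman2014, §3.1 (28), §3.3] -/
theorem stressEnergy_timeVector_leafNormal_le_sum_sq_core {M a c H : ℝ} {hgt : E3 → ℝ}
    (hMa : IsSubextremal M a) (ψ : region a (rPlus M a) → ℝ) (t : ℝ) (y : E3)
    (hx : E4.ofTimeSpace t y ∈ region a (rPlus M a))
    (hh : fderiv ℝ hgt y = c • radiusGrad a y) (hH : scalarH M a (E4.ofTimeSpace t y) = H)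
    (hc0 : 0 ≤ c) (hc3 : c ≤ 3) :
    (smoothMetric M a (rPlus M a)).stressEnergy ψ ⟨E4.ofTimeSpace t y, hx⟩
        (timeVector M a (E4.ofTimeSpace t y)) (leafNormal M a hgt ⟨E4.ofTimeSpace t y, hx⟩) ≤
      250 * ∑ μ : Fin 4, dcov ψ ⟨E4.ofTimeSpace t y, hx⟩ (E4.basisVector μ) ^ 2 := by
  have hxr : rPlus M a < radius a (E4.ofTimeSpace 0 y) := by
    rw [← radius_ofTimeSpace a t y]; exact lt_radius_of_mem_region hx
  have hM := hMa.pos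
  have hr0 : 0 < radius a (E4.ofTimeSpace 0 y) := hMa.rPlus_pos.trans hxr
  have hxpos : 0 < radius a (E4.ofTimeSpace t y) := radius_pos_of_mem_region hx
  have hS := blSigma_pos hr0
  -- `H ∈ [0, 1]`
  have hH0 : 0 ≤ H := hH ▸ scalarH_nonneg hM.le a _
  have hH1 : H ≤ 1 := hH ▸ scalarH_ofTimeSpace_le_one' hMa t hxr
  have hHeq : H = M * radius a (E4.ofTimeSpace 0 y) / blSigma a y :=
    hH ▸ scalarH_ofTimeSpace_eq t hr0
  -- `|ℓ⃗| = 1`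
  have hl : nullCovectorFun a (E4.ofTimeSpace t y) 1 ^ 2 + nullCovectorFun a (E4.ofTimeSpace t y) 2 ^ 2 + nullCovectorFun a (E4.ofTimeSpace t y) 3 ^ 2 = 1 := sum_sq_nullCovectorFun hxpos
  -- `|k⃗|² = c²(r² + a²)/Σ ≤ 18`
  have hK2 : ((c * radiusGradVec a y 0) ^ 2 + (c * radiusGradVec a y 1) ^ 2 + (c * radiusGradVec a y 2) ^ 2) =
      c ^ 2 * ((radius a (E4.ofTimeSpace 0 y) ^ 2 + a ^ 2) / blSigma a y) := by
    have h1 := inner_radiusGradVec_self hr0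
    rw [real_inner_self_eq_norm_sq, E3.norm_sq] at h1
    rw [← h1]
    ring
  have hK18 : ((c * radiusGradVec a y 0) ^ 2 + (c * radiusGradVec a y 1) ^ 2 + (c * radiusGradVec a y 2) ^ 2) ≤ 18 := by
    rw [hK2]
    have hq0 : 0 ≤ (radius a (E4.ofTimeSpace 0 y) ^ 2 + a ^ 2) / blSigma a y := by positivity
    have hq2 := sq_add_sq_div_blSigma_le_two' hMa hxr
    have hc9 : c ^ 2 ≤ 9 := by nlinarith
    nlinarith [mul_le_mul hc9 hq2 hq0 (by norm_num)]
  -- the flux density in components (as in `Kerr.leafCoercivity_pointwise_core`)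
  have hpl : dcov ψ ⟨E4.ofTimeSpace t y, hx⟩ (nullVector a (E4.ofTimeSpace t y)) = -dcov ψ ⟨E4.ofTimeSpace t y, hx⟩ (E4.basisVector 0) + (nullCovectorFun a (E4.ofTimeSpace t y) 1 * dcov ψ ⟨E4.ofTimeSpace t y, hx⟩ (E4.basisVector 1) + nullCovectorFun a (E4.ofTimeSpace t y) 2 * dcov ψ ⟨E4.ofTimeSpace t y, hx⟩ (E4.basisVector 2) + nullCovectorFun a (E4.ofTimeSpace t y) 3 * dcov ψ ⟨E4.ofTimeSpace t y, hx⟩ (E4.basisVector 3)) := by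
    rw [E4.linearMap_apply_eq_sum, Fin.sum_univ_four]
    simp only [nullVector_apply_zero, nullVector_apply_one, nullVector_apply_two,
      nullVector_apply_three]
    ring
  have hpV : dcov ψ ⟨E4.ofTimeSpace t y, hx⟩ (timeVector M a (E4.ofTimeSpace t y)) =
      dcov ψ ⟨E4.ofTimeSpace t y, hx⟩ (E4.basisVector 0) - 2 * H * dcov ψ ⟨E4.ofTimeSpace t y, hx⟩ (nullVector a (E4.ofTimeSpace t y)) := by
    simp only [timeVector, map_sub, map_smul, smul_eq_mul, hH]
  have hν0 : leafConormal hgt (E4.ofTimeSpace t y) (E4.basisVector 0) = 1 := by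
    rw [leafConormal_apply_of_radial hh]
    simp [E4.spatial_basisVector_zero]
  have hν1 : leafConormal hgt (E4.ofTimeSpace t y) (E4.basisVector 1) = -(c * radiusGradVec a y 0) := by
    rw [leafConormal_apply_of_radial hh, E4.spatial_basisVector_one, radiusGrad_single]
    simp
  have hν2 : leafConormal hgt (E4.ofTimeSpace t y) (E4.basisVector 2) = -(c * radiusGradVec a y 1) := by
    rw [leafConormal_apply_of_radial hh, E4.spatial_basisVector_two, radiusGrad_single]
    simp
  have hν3 : leafConormal hgt (E4.ofTimeSpace t y) (E4.basisVector 3) = -(c * radiusGradVec a y 2) := by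
    rw [leafConormal_apply_of_radial hh, E4.spatial_basisVector_three, radiusGrad_single]
    simp
  have hνl : leafConormal hgt (E4.ofTimeSpace t y) (nullVector a (E4.ofTimeSpace t y)) = -(1 + c) :=
    leafConormal_nullVector_of_radial hh hr0
  have hνV : leafConormal hgt (E4.ofTimeSpace t y) (timeVector M a (E4.ofTimeSpace t y)) = 1 + 2 * H * (1 + c) := by
    rw [leafConormal_timeVector_of_radial hh hr0, hH]
  have hW : leafNormal M a hgt ⟨E4.ofTimeSpace t y, hx⟩ = -coSharp M a (E4.ofTimeSpace t y) (leafConormal hgt (E4.ofTimeSpace t y)) := by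
    rw [leafNormal, sharp_smoothMetric]
    rfl
  have hpW : dcov ψ ⟨E4.ofTimeSpace t y, hx⟩ (leafNormal M a hgt ⟨E4.ofTimeSpace t y, hx⟩) =
      -((-dcov ψ ⟨E4.ofTimeSpace t y, hx⟩ (E4.basisVector 0) - ((c * radiusGradVec a y 0) * dcov ψ ⟨E4.ofTimeSpace t y, hx⟩ (E4.basisVector 1) + (c * radiusGradVec a y 1) * dcov ψ ⟨E4.ofTimeSpace t y, hx⟩ (E4.basisVector 2) + (c * radiusGradVec a y 2) * dcov ψ ⟨E4.ofTimeSpace t y, hx⟩ (E4.basisVector 3))) -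
        2 * H * (-(1 + c)) * dcov ψ ⟨E4.ofTimeSpace t y, hx⟩ (nullVector a (E4.ofTimeSpace t y))) := by
    rw [hW, map_neg, coSharp, map_sub, map_smul, smul_eq_mul, hνl, hH,
      E4.linearMap_apply_eq_sum _ (etaSharp _), Fin.sum_univ_four]
    simp only [etaSharp_apply_zero, etaSharp_apply_one, etaSharp_apply_two, etaSharp_apply_three,
      hν0, hν1, hν2, hν3]
    ring
  have hVW : (smoothMetric M a (rPlus M a)).val ⟨E4.ofTimeSpace t y, hx⟩ (timeVector M a (E4.ofTimeSpace t y))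
      (leafNormal M a hgt ⟨E4.ofTimeSpace t y, hx⟩) = -(1 + 2 * H * (1 + c)) := by
    rw [smoothMetric_val, ← hνV]
    exact bilin_timeVector_leafNormal M a hgt ⟨E4.ofTimeSpace t y, hx⟩
  have hgrad : (smoothMetric M a (rPlus M a)).gradSq ψ ⟨E4.ofTimeSpace t y, hx⟩ =
      -dcov ψ ⟨E4.ofTimeSpace t y, hx⟩ (E4.basisVector 0) ^ 2 + (dcov ψ ⟨E4.ofTimeSpace t y, hx⟩ (E4.basisVector 1) ^ 2 + dcov ψ ⟨E4.ofTimeSpace t y, hx⟩ (E4.basisVector 2) ^ 2 + dcov ψ ⟨E4.ofTimeSpace t y, hx⟩ (E4.basisVector 3) ^ 2) -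
        2 * H * dcov ψ ⟨E4.ofTimeSpace t y, hx⟩ (nullVector a (E4.ofTimeSpace t y)) ^ 2 := by
    rw [PseudoRiemannianMetric.gradSq, PseudoRiemannianMetric.innerDual, sharp_smoothMetric]
    change dcov ψ ⟨E4.ofTimeSpace t y, hx⟩ (coSharp M a (E4.ofTimeSpace t y) (dcov ψ ⟨E4.ofTimeSpace t y, hx⟩)) = _
    simp only [coSharp, map_sub, map_smul, smul_eq_mul, apply_etaSharp, hH]
    ring
  have hT : (smoothMetric M a (rPlus M a)).stressEnergy ψ ⟨E4.ofTimeSpace t y, hx⟩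
          (timeVector M a (E4.ofTimeSpace t y)) (leafNormal M a hgt ⟨E4.ofTimeSpace t y, hx⟩) =
      -((1 + 2 * H) * dcov ψ ⟨E4.ofTimeSpace t y, hx⟩ (E4.basisVector 0) - 2 * H * (nullCovectorFun a (E4.ofTimeSpace t y) 1 * dcov ψ ⟨E4.ofTimeSpace t y, hx⟩ (E4.basisVector 1) + nullCovectorFun a (E4.ofTimeSpace t y) 2 * dcov ψ ⟨E4.ofTimeSpace t y, hx⟩ (E4.basisVector 2) + nullCovectorFun a (E4.ofTimeSpace t y) 3 * dcov ψ ⟨E4.ofTimeSpace t y, hx⟩ (E4.basisVector 3))) *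
            (-dcov ψ ⟨E4.ofTimeSpace t y, hx⟩ (E4.basisVector 0) - ((c * radiusGradVec a y 0) * dcov ψ ⟨E4.ofTimeSpace t y, hx⟩ (E4.basisVector 1) + (c * radiusGradVec a y 1) * dcov ψ ⟨E4.ofTimeSpace t y, hx⟩ (E4.basisVector 2) + (c * radiusGradVec a y 2) * dcov ψ ⟨E4.ofTimeSpace t y, hx⟩ (E4.basisVector 3)) -
              2 * H * (1 + c) * (dcov ψ ⟨E4.ofTimeSpace t y, hx⟩ (E4.basisVector 0) - (nullCovectorFun a (E4.ofTimeSpace t y) 1 * dcov ψ ⟨E4.ofTimeSpace t y, hx⟩ (E4.basisVector 1) + nullCovectorFun a (E4.ofTimeSpace t y) 2 * dcov ψ ⟨E4.ofTimeSpace t y, hx⟩ (E4.basisVector 2) + nullCovectorFun a (E4.ofTimeSpace t y) 3 * dcov ψ ⟨E4.ofTimeSpace t y, hx⟩ (E4.basisVector 3)))) +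
          (1 + 2 * H * (1 + c)) / 2 *
            (-dcov ψ ⟨E4.ofTimeSpace t y, hx⟩ (E4.basisVector 0) ^ 2 + (dcov ψ ⟨E4.ofTimeSpace t y, hx⟩ (E4.basisVector 1) ^ 2 + dcov ψ ⟨E4.ofTimeSpace t y, hx⟩ (E4.basisVector 2) ^ 2 + dcov ψ ⟨E4.ofTimeSpace t y, hx⟩ (E4.basisVector 3) ^ 2) -
              2 * H * (-dcov ψ ⟨E4.ofTimeSpace t y, hx⟩ (E4.basisVector 0) + (nullCovectorFun a (E4.ofTimeSpace t y) 1 * dcov ψ ⟨E4.ofTimeSpace t y, hx⟩ (E4.basisVector 1) + nullCovectorFun a (E4.ofTimeSpace t y) 2 * dcov ψ ⟨E4.ofTimeSpace t y, hx⟩ (E4.basisVector 2) + nullCovectorFun a (E4.ofTimeSpace t y) 3 * dcov ψ ⟨E4.ofTimeSpace t y, hx⟩ (E4.basisVector 3))) ^ 2) := by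
    rw [PseudoRiemannianMetric.stressEnergy_apply]
    simp only [mvfderiv_apply_eq_dcov]
    rw [hpV, hpW, hgrad, hVW, hpl]
    ring
  -- the algebra
  have halg := leafFluxUpper_alg H (dcov ψ ⟨E4.ofTimeSpace t y, hx⟩ (E4.basisVector 0)) (dcov ψ ⟨E4.ofTimeSpace t y, hx⟩ (E4.basisVector 1)) (dcov ψ ⟨E4.ofTimeSpace t y, hx⟩ (E4.basisVector 2)) (dcov ψ ⟨E4.ofTimeSpace t y, hx⟩ (E4.basisVector 3)) (c * radiusGradVec a y 0) (c * radiusGradVec a y 1) (c * radiusGradVec a y 2)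
    (nullCovectorFun a (E4.ofTimeSpace t y) 1) (nullCovectorFun a (E4.ofTimeSpace t y) 2) (nullCovectorFun a (E4.ofTimeSpace t y) 3) c hH0 hH1 hl hK18 hc0 hc3
  rw [← hT] at halg
  rw [Fin.sum_univ_four]
  linarith

/-- **The flux density through the leaves of a cut-off graph foliation is at most `250 ×` the
coordinate energy density.** For `|a| < M`, a far slope `σ` continuous on `(r₊, ∞)` with
`0 ≤ σ ≤ σ♯ = scriSlope M a` there, `R₁ ≥ 4M`, every scalar field `ψ` and every exterior point
`x = (t, y)`, with `h = cutoffHeight σ a R₁` and `W_h = −g♯d(t* − h)`: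
`T[ψ](V, W_h)(x) ≤ 250 ∑_μ (dψ_x(∂_μ))²` — the slope `c = χ((r − R₁)/R₁) σ(r)` of the leaf lies in
`[0, 3)` and `Kerr.stressEnergy_timeVector_leafNormal_le_sum_sq_core` applies. This is the bound
"the flux density is `≤ C ∑(∂ψ)²`" of clause (A4) of `Kerr.drsr_theorems_3_1_3_2_scri`, with an
absolute constant and for every radius (cf. `Kerr.stressEnergy_timeVector_le_sum_sq_of_isSubextremal`
for the slices, `Kerr.leafCoercivity_pointwise` for the converse). DRSR arXiv:1402.7034, §3.1 (28),
§3.3. [cite: DafermosRodnianskiShlapentokhrothman2014, §3.1 (28), §3.3] -/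
theorem stressEnergy_timeVector_leafNormal_cutoffHeight_le_sum_sq {M a R₁ : ℝ} {σ : ℝ → ℝ}
    (hMa : IsSubextremal M a) (hσc : ContinuousOn σ (Ioi (rPlus M a)))
    (hσ0 : ∀ s, rPlus M a < s → 0 ≤ σ s) (hσ1 : ∀ s, rPlus M a < s → σ s ≤ scriSlope M a s)
    (hR : 4 * M ≤ R₁) (ψ : region a (rPlus M a) → ℝ) (t : ℝ) (y : E3)
    (hx : E4.ofTimeSpace t y ∈ region a (rPlus M a)) :
    (smoothMetric M a (rPlus M a)).stressEnergy ψ ⟨E4.ofTimeSpace t y, hx⟩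
        (timeVector M a (E4.ofTimeSpace t y))
        (leafNormal M a (cutoffHeight σ a R₁) ⟨E4.ofTimeSpace t y, hx⟩) ≤
      250 * ∑ μ : Fin 4, dcov ψ ⟨E4.ofTimeSpace t y, hx⟩ (E4.basisVector μ) ^ 2 := by
  have hxr : rPlus M a < radius a (E4.ofTimeSpace 0 y) := by
    rw [← radius_ofTimeSpace a t y]; exact lt_radius_of_mem_region hx
  have hM := hMa.pos
  have hrp0 := hMa.rPlus_pos
  have hR0 : 0 < R₁ := by linarith
  have hRp : rPlus M a < R₁ := (rPlus_le_two_mul hM.le).trans_lt (by linarith)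
  -- the slope `c` of the leaf at `y`: `dh_y = c · dr`
  obtain ⟨c, hc⟩ : ∃ c : ℝ, Real.smoothTransition ((radius a (E4.ofTimeSpace 0 y) - R₁) / R₁) *
      σ (radius a (E4.ofTimeSpace 0 y)) = c := ⟨_, rfl⟩
  have hh : fderiv ℝ (cutoffHeight σ a R₁) y = c • radiusGrad a y := by
    rw [← hc]; exact (hasFDerivAt_cutoffHeight hrp0.le hσc hRp hxr).fderiv
  have hχ0 := Real.smoothTransition.nonneg ((radius a (E4.ofTimeSpace 0 y) - R₁) / R₁)
  have hχ1 := Real.smoothTransition.le_one ((radius a (E4.ofTimeSpace 0 y) - R₁) / R₁)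
  have hσr := hσ0 _ hxr
  have hc0 : 0 ≤ c := hc ▸ mul_nonneg hχ0 hσr
  have hcσ : c ≤ scriSlope M a (radius a (E4.ofTimeSpace 0 y)) := by
    rw [← hc]
    calc _ ≤ 1 * σ (radius a (E4.ofTimeSpace 0 y)) := mul_le_mul_of_nonneg_right hχ1 hσr
      _ ≤ _ := by rw [one_mul]; exact hσ1 _ hxr
  have hc3 : c ≤ 3 := by
    by_cases hrR : radius a (E4.ofTimeSpace 0 y) ≤ R₁
    · have : (radius a (E4.ofTimeSpace 0 y) - R₁) / R₁ ≤ 0 :=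
        div_nonpos_of_nonpos_of_nonneg (by linarith) hR0.le
      rw [← hc, Real.smoothTransition.zero_of_nonpos this, zero_mul]
      norm_num
    · have h4 : 4 * M ≤ radius a (E4.ofTimeSpace 0 y) := by linarith [not_le.1 hrR]
      exact hcσ.trans (scriSlope_lt_three' hMa h4).le
  exact stressEnergy_timeVector_leafNormal_le_sum_sq_core hMa ψ t y hx hh rfl hc0 hc3

/-- **The flux density through the leaves `Σ̃_τ(h♯_{R₁})` of facts A and B is at most `250 ×` the
coordinate energy density `∑_μ (∂_μψ̃)²`** of the prelude (`coordEnergyDensity`), at every exterior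
point, for `|a| < M` and `R₁ ≥ 4M`. DRSR arXiv:1402.7034, §3.1 (28), §3.3.
[cite: DafermosRodnianskiShlapentokhrothman2014, §3.1 (28), §3.3] -/
theorem stressEnergy_timeVector_leafNormal_scriHeight_le_coordEnergyDensity {M a R₁ : ℝ}
    (hMa : IsSubextremal M a) (hR : 4 * M ≤ R₁) (ψ : region a (rPlus M a) → ℝ) (t : ℝ) (y : E3)
    (hx : E4.ofTimeSpace t y ∈ region a (rPlus M a)) :
    (smoothMetric M a (rPlus M a)).stressEnergy ψ ⟨E4.ofTimeSpace t y, hx⟩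
        (timeVector M a (E4.ofTimeSpace t y))
        (leafNormal M a (scriHeight M a R₁) ⟨E4.ofTimeSpace t y, hx⟩) ≤
      250 * coordEnergyDensity (region a (rPlus M a)) ψ (E4.ofTimeSpace t y) := by
  have h := stressEnergy_timeVector_leafNormal_cutoffHeight_le_sum_sq hMa
    (contDiffOn_scriSlope hMa).continuousOn (fun _ hs ↦ (scriSlope_pos hMa hs).le)
    (fun _ _ ↦ le_rfl) hR ψ t y hx
  rw [scriHeight_eq_cutoffHeight]
  rw [coordEnergyDensity_eq_sum_sq_mvfderiv ψ ⟨E4.ofTimeSpace t y, hx⟩]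
  simpa only [mvfderiv_apply_eq_dcov] using h

open scoped Classical in
/-- **The leaf flux density is at most `250 ×` the cut-off coordinate energy density**, as
`[0, ∞]`-valued functions of `y ∈ E3`, for the leaves `Σ̃_τ(h♯_{R₁})` (`|a| < M`, `R₁ ≥ 4M`):
`leafFluxDensity … (h♯_{R₁}) ψ τ y ≤ 250 · 1_{r>r₊} ∑_μ (∂_μψ̃)²(τ + h♯(y), y)` (the pattern of
`Kerr.leafFluxDensity_le_indicator_coordEnergyDensity` for the slices). DRSR arXiv:1402.7034,
§3.1 (28), §3.3. [cite: DafermosRodnianskiShlapentokhrothman2014, §3.1 (28), §3.3] -/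
theorem leafFluxDensity_scriHeight_le_coordEnergyDensity {M a R₁ : ℝ} (hMa : IsSubextremal M a)
    (hR : 4 * M ≤ R₁) (ψ : region a (rPlus M a) → ℝ) (τ : ℝ) (y : E3) :
    leafFluxDensity M a (scriHeight M a R₁) ψ τ y ≤
      250 * (if leafPoint (scriHeight M a R₁) τ y ∈ region a (rPlus M a) then
        ENNReal.ofReal (coordEnergyDensity (region a (rPlus M a)) ψ
          (leafPoint (scriHeight M a R₁) τ y)) else 0) := by
  by_cases hy : leafPoint (scriHeight M a R₁) τ y ∈ region a (rPlus M a)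
  · rw [leafFluxDensity_of_mem _ _ _ hy, if_pos hy, ← ENNReal.ofReal_ofNat 250,
      ← ENNReal.ofReal_mul (by norm_num)]
    exact ENNReal.ofReal_le_ofReal
      (stressEnergy_timeVector_leafNormal_scriHeight_le_coordEnergyDensity hMa hR ψ _ y hy)
  · rw [leafFluxDensity_of_not_mem _ _ _ hy, if_neg hy, mul_zero]

end UpperComparability

end Kerr

/-! ### DRSR §4.1 for the class `IsAdmissibleKerrWave`: admissible waves extend across `𝓗⁺`

The class `IsAdmissibleKerrWave` consists of smooth solutions on the *open* exterior `{r > r₊}` with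
data compactly supported in the open slice `{t* = 0, r > r₊}`; DRSR work with solutions on
`𝓡 ⊃ 𝓗⁺` arising from smooth compactly supported data on a slice `Σ₀` crossing the horizon
(arXiv:1402.7034, §2.2.5, §4.1), to which the red-shift estimates near `𝓗⁺` apply. The passage from
the former to the latter is: extend the data by zero, solve the Cauchy problem on the
horizon-penetrating chart, and identify the two solutions on `{t* ≥ 0} ∩ {r > r₊}` by the domain of
dependence in the exterior. The Cauchy problem is the named fact `KerrSchild.waveCauchyProblem`
(hypothesis `h` below); everything else is proved. -/

section HorizonRegularExtension

/-- **Functions with the same Cauchy data near a point of `{t* = 0}` have the same differential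
there** (local form of `E4.fderiv_eq_of_data_eq` of `KerrSchildEnergyEstimate.lean`): if `F, G`
are differentiable at `(0, y)`, agree at the slice points `(0, y')` for `y'` near `y`, and have the
same time derivative at `(0, y)`, then `dF(0, y) = dG(0, y)` (tangential derivatives by the chain
rule along `y' ↦ (0, y')`, `E4.hasFDerivAt_ofTimeSpace`). [folklore] -/
theorem E4.fderiv_eq_of_data_eventuallyEq {F G : E4 → ℝ} {y : E3}
    (hF : DifferentiableAt ℝ F (E4.ofTimeSpace 0 y))
    (hG : DifferentiableAt ℝ G (E4.ofTimeSpace 0 y))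
    (h0 : (fun y' : E3 ↦ F (E4.ofTimeSpace 0 y')) =ᶠ[𝓝 y] fun y' ↦ G (E4.ofTimeSpace 0 y'))
    (h1 : fderiv ℝ F (E4.ofTimeSpace 0 y) (E4.basisVector 0) =
      fderiv ℝ G (E4.ofTimeSpace 0 y) (E4.basisVector 0)) :
    fderiv ℝ F (E4.ofTimeSpace 0 y) = fderiv ℝ G (E4.ofTimeSpace 0 y) := by
  have hcF : HasFDerivAt (fun y' : E3 ↦ F (E4.ofTimeSpace 0 y'))
      ((fderiv ℝ F (E4.ofTimeSpace 0 y)).comp E4.spaceEmbed) y :=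
    hF.hasFDerivAt.comp y (E4.hasFDerivAt_ofTimeSpace 0 y)
  have hcG : HasFDerivAt (fun y' : E3 ↦ G (E4.ofTimeSpace 0 y'))
      ((fderiv ℝ G (E4.ofTimeSpace 0 y)).comp E4.spaceEmbed) y :=
    hG.hasFDerivAt.comp y (E4.hasFDerivAt_ofTimeSpace 0 y)
  have hsp : (fderiv ℝ F (E4.ofTimeSpace 0 y)).comp E4.spaceEmbed =
      (fderiv ℝ G (E4.ofTimeSpace 0 y)).comp E4.spaceEmbed := by
    rw [← hcF.fderiv, ← hcG.fderiv]
    exact h0.fderiv_eq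
  refine ContinuousLinearMap.ext fun v ↦ ?_
  have hv : v = v 0 • E4.basisVector 0 + E4.spaceEmbed (E4.spatial v) := by
    conv_lhs => rw [← E4.ofTimeSpace_time_spatial v]
    rw [E4.ofTimeSpace_eq_smul_add', E4.time_apply]
  have hw : fderiv ℝ F (E4.ofTimeSpace 0 y) (E4.spaceEmbed (E4.spatial v)) =
      fderiv ℝ G (E4.ofTimeSpace 0 y) (E4.spaceEmbed (E4.spatial v)) := by
    have := congrArg (fun L : E3 →L[ℝ] ℝ ↦ L (E4.spatial v)) hsp
    simpa only [ContinuousLinearMap.coe_comp, Function.comp_apply] using this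
  rw [hv, map_add, map_add, map_smul, map_smul, h1, hw]

/-- **Local linearity of the divergence-form wave operator**: `□_G (f − g)(x) = □_G f(x) − □_G g(x)`
for coefficients differentiable on `ℝ⁴` and functions `f, g` of class `C²` on a neighbourhood of
`x` (the operator `KerrSchild.waveOperator` only involves derivatives at and near `x`; compare the
global `waveOperator_sub` of `TrappingDerivativeLossEnergy.lean`). [folklore] -/
theorem KerrSchild.waveOperator_sub_local {G : E4 → Fin 4 → Fin 4 → ℝ}
    (hG : ∀ μ ν, Differentiable ℝ fun y ↦ G y μ ν) {f g : E4 → ℝ} {x : E4}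
    (hf : ∀ᶠ y in 𝓝 x, ContDiffAt ℝ 2 f y) (hg : ∀ᶠ y in 𝓝 x, ContDiffAt ℝ 2 g y) :
    KerrSchild.waveOperator G (f - g) x =
      KerrSchild.waveOperator G f x - KerrSchild.waveOperator G g x := by
  unfold KerrSchild.waveOperator
  rw [← Finset.sum_sub_distrib]
  refine Finset.sum_congr rfl fun μ _ ↦ ?_
  have hev : (fun y ↦ ∑ ν, G y μ ν * fderiv ℝ (f - g) y (E4.basisVector ν)) =ᶠ[𝓝 x]
      fun y ↦ (∑ ν, G y μ ν * fderiv ℝ f y (E4.basisVector ν)) -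
        ∑ ν, G y μ ν * fderiv ℝ g y (E4.basisVector ν) := by
    filter_upwards [hf, hg] with y hfy hgy
    rw [fderiv_sub (hfy.differentiableAt (by simp)) (hgy.differentiableAt (by simp)),
      ← Finset.sum_sub_distrib]
    refine Finset.sum_congr rfl fun ν _ ↦ ?_
    rw [sub_apply, mul_sub]
  rw [hev.fderiv_eq]
  have hdf : ∀ ν, DifferentiableAt ℝ (fun y ↦ fderiv ℝ f y (E4.basisVector ν)) x := fun ν ↦
    ((hf.self_of_nhds.fderiv_right (m := 1) le_rfl).differentiableAt (by simp)).clm_apply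
      (differentiableAt_const _)
  have hdg : ∀ ν, DifferentiableAt ℝ (fun y ↦ fderiv ℝ g y (E4.basisVector ν)) x := fun ν ↦
    ((hg.self_of_nhds.fderiv_right (m := 1) le_rfl).differentiableAt (by simp)).clm_apply
      (differentiableAt_const _)
  have h1 : DifferentiableAt ℝ (fun y ↦ ∑ ν, G y μ ν * fderiv ℝ f y (E4.basisVector ν)) x :=
    DifferentiableAt.fun_sum fun ν _ ↦ ((hG μ ν) x).mul (hdf ν)
  have h2 : DifferentiableAt ℝ (fun y ↦ ∑ ν, G y μ ν * fderiv ℝ g y (E4.basisVector ν)) x :=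
    DifferentiableAt.fun_sum fun ν _ ↦ ((hG μ ν) x).mul (hdg ν)
  rw [fderiv_fun_sub h1 h2, sub_apply]

variable [Kerr.Facts] [Kerr.SliceFacts]

/-- **The Cauchy data of an admissible wave as smooth compactly supported functions on `ℝ³`.**
For an admissible wave `ψ` on the Kerr exterior there are a compact `K` inside the open exterior
slice `{r > r₊} ⊆ ℝ³` and `ψ₀, ψ₁ ∈ C^∞(ℝ³)` vanishing off `K` which on the slice are the data
`ψ₀(y) = ψ(0, y)`, `ψ₁(y) = ∂_{t*}ψ(0, y)` (through the extension by zero `ψ̃` of `ψ` to `ℝ⁴`, which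
represents `ψ` on the open exterior): the zero extension of the data across the horizon sphere
`{r = r₊}` and the interior, smooth because the data already vanish on a neighbourhood of the
boundary of the slice. This is the first step of DRSR's reduction (arXiv:1402.7034, §4.1:
"general solutions of the Cauchy problem on `𝓡₀` … arising from smooth compactly supported data
on `Σ₀`", `Σ₀` crossing `𝓗⁺`). [cite: DafermosRodnianskiShlapentokhrothman2014, §4.1] -/
theorem IsAdmissibleKerrWave.exists_sliceData {M a : ℝ} {ψ : Kerr.exterior M a → ℝ}
    (hψ : IsAdmissibleKerrWave M a ψ) :
    ∃ (K : Set E3) (ψ₀ ψ₁ : E3 → ℝ), IsCompact K ∧ K ⊆ (Kerr.slice a (Kerr.rPlus M a) : Set E3) ∧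
      ContDiff ℝ ∞ ψ₀ ∧ ContDiff ℝ ∞ ψ₁ ∧ (∀ y, y ∉ K → ψ₀ y = 0) ∧ (∀ y, y ∉ K → ψ₁ y = 0) ∧
      ∀ y ∈ Kerr.slice a (Kerr.rPlus M a),
        ψ₀ y = Function.extend Subtype.val ψ 0 (E4.ofTimeSpace 0 y) ∧
        ψ₁ y = fderiv ℝ (Function.extend Subtype.val ψ 0) (E4.ofTimeSpace 0 y)
          (E4.basisVector 0) := by
  classical
  obtain ⟨K, hK, hKs, hdata⟩ := hψ.exists_spatial_dataSupport
  have hrep : ∀ z : Kerr.exterior M a, ψ z = Function.extend Subtype.val ψ 0 z := extend_rep ψ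
  have hΦs : ∀ z : Kerr.exterior M a, ContDiffAt ℝ ∞ (Function.extend Subtype.val ψ 0) z :=
    contDiffAt_extend hψ.contMDiff
  have hoff : ∀ y : E3, y ∉ Kerr.slice a (Kerr.rPlus M a) →
      Function.extend Subtype.val ψ 0 (E4.ofTimeSpace 0 y) = 0 := fun y hy ↦
    extend_of_not_mem ψ hy
  generalize Function.extend Subtype.val ψ 0 = Φ at hrep hΦs hoff
  -- slice points are exterior points
  have hpt : ∀ {y : E3}, y ∈ Kerr.slice a (Kerr.rPlus M a) →
      E4.ofTimeSpace 0 y ∈ Kerr.exterior M a := fun hy ↦ hy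
  -- the data vanish off `K`
  have h0 : ∀ y, y ∉ K → Φ (E4.ofTimeSpace 0 y) = 0 := by
    intro y hyK
    by_cases hy : y ∈ Kerr.slice a (Kerr.rPlus M a)
    · have h := (hdata ⟨E4.ofTimeSpace 0 y, hpt hy⟩ (by simp) (by simpa using hyK)).1
      rwa [hrep] at h
    · exact hoff y hy
  have h1 : ∀ y, y ∉ K →
      (if y ∈ Kerr.slice a (Kerr.rPlus M a) then fderiv ℝ Φ (E4.ofTimeSpace 0 y) (E4.basisVector 0)
        else 0) = 0 := by
    intro y hyK
    by_cases hy : y ∈ Kerr.slice a (Kerr.rPlus M a)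
    · rw [if_pos hy]
      have h := (hdata ⟨E4.ofTimeSpace 0 y, hpt hy⟩ (by simp) (by simpa using hyK)).2
      rw [OpensChart.mfderiv_eq _ ψ Φ hrep ((hΦs _).differentiableAt (by simp))] at h
      have h' : fderiv ℝ Φ (E4.ofTimeSpace 0 y) = 0 := h
      rw [h']
      rfl
    · rw [if_neg hy]
  refine ⟨K, fun y ↦ Φ (E4.ofTimeSpace 0 y),
    fun y ↦ if y ∈ Kerr.slice a (Kerr.rPlus M a) then
      fderiv ℝ Φ (E4.ofTimeSpace 0 y) (E4.basisVector 0) else 0,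
    hK, hKs, ?_, ?_, h0, h1, fun y hy ↦ ⟨rfl, if_pos hy⟩⟩
  · -- smoothness of `ψ₀`
    refine contDiff_iff_contDiffAt.2 fun y ↦ ?_
    by_cases hy : y ∈ Kerr.slice a (Kerr.rPlus M a)
    · exact (hΦs ⟨_, hpt hy⟩).comp y (E4.contDiff_ofTimeSpace 0).contDiffAt
    · have hyK : y ∉ K := fun h ↦ hy (hKs h)
      have hev : (fun y' ↦ Φ (E4.ofTimeSpace 0 y')) =ᶠ[𝓝 y] fun _ ↦ 0 := by
        filter_upwards [hK.isClosed.isOpen_compl.mem_nhds hyK] with y' hy'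
        exact h0 y' hy'
      exact contDiffAt_const.congr_of_eventuallyEq hev
  · -- smoothness of `ψ₁`
    refine contDiff_iff_contDiffAt.2 fun y ↦ ?_
    by_cases hy : y ∈ Kerr.slice a (Kerr.rPlus M a)
    · have hev : (fun y' ↦ if y' ∈ Kerr.slice a (Kerr.rPlus M a) then
          fderiv ℝ Φ (E4.ofTimeSpace 0 y') (E4.basisVector 0) else 0) =ᶠ[𝓝 y]
          fun y' ↦ fderiv ℝ Φ (E4.ofTimeSpace 0 y') (E4.basisVector 0) := by
        filter_upwards [(Kerr.slice a (Kerr.rPlus M a)).isOpen.mem_nhds hy] with y' hy'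
        exact if_pos hy'
      refine ContDiffAt.congr_of_eventuallyEq ?_ hev
      exact (contDiffAt_fderiv_apply_const_infty (hΦs ⟨_, hpt hy⟩) _).comp y
        (E4.contDiff_ofTimeSpace 0).contDiffAt
    · have hyK : y ∉ K := fun h ↦ hy (hKs h)
      have hev : (fun y' ↦ if y' ∈ Kerr.slice a (Kerr.rPlus M a) then
          fderiv ℝ Φ (E4.ofTimeSpace 0 y') (E4.basisVector 0) else 0) =ᶠ[𝓝 y] fun _ ↦ 0 := by
        filter_upwards [hK.isClosed.isOpen_compl.mem_nhds hyK] with y' hy'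
        exact h1 y' hy'
      exact contDiffAt_const.congr_of_eventuallyEq hev

/-- **Admissible waves extend smoothly across the future event horizon (DRSR §4.1 for the class
`IsAdmissibleKerrWave`, from the Cauchy problem on Kerr–Schild backgrounds).** Let `|a| < M`,
`0 < r₀ ≤ r₊`, and let `ψ` be an admissible wave on the Kerr exterior `{r > r₊}` (smooth solution
of `□_g ψ = 0` with data compactly supported in the open slice `{t* = 0, r > r₊}`). Assuming the
named fact `KerrSchild.waveCauchyProblem` (Bär–Ginoux–Pfäffle 2007, Thm. 3.2.11, on the surgered
Kerr–Schild background, `KerrSchildWaveCauchyProblem.lean`), there is a smooth solution `Ψ` of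
`□_{g_{M,a}} Ψ = 0` on the whole horizon-penetrating chart `Kerr.region a r₀ = {r > r₀} ⊇ 𝓗⁺`, whose
Cauchy data on the chart slice `{t* = 0, r > r₀}` vanish (`Ψ = 0`, `dΨ = 0`) off a compact subset
of the *open exterior* slice, and which coincides with `ψ` at every exterior point with `t* ≥ 0`.
Thus on `{t* ≥ 0}` every admissible wave is the restriction of a solution regular up to and
through `𝓗⁺` arising from smooth compactly supported data on a slice crossing the horizon — the
class of DRSR, arXiv:1402.7034, §4.1 ("by standard density arguments, we immediately reduce to
`ψ` arising from smooth, compactly supported data on `Σ₀`"; `Σ₀` crosses `𝓗⁺`, §2.2.5), on which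
the red-shift estimates of Prop. 4.5.2 act. Proof: extend the data by zero
(`IsAdmissibleKerrWave.exists_sliceData`), solve on `{r > r₀}` (`Kerr.exists_wave_of_data`), and
apply the domain of dependence in the exterior (`Kerr.vanish_of_data_ball`, Hawking–Ellis 1973,
§4.3) to the difference, a smooth solution on the exterior with vanishing data on the whole
exterior slice (`KerrSchild.waveOperator_sub_local`, `E4.fderiv_eq_of_data_eventuallyEq`).
[cite: DafermosRodnianskiShlapentokhrothman2014, §4.1; BarGinouxPfaffle2007, Thm. 3.2.11; HawkingEllis1973CUP, §4.3] -/
theorem IsAdmissibleKerrWave.exists_horizonRegular_extension (h : KerrSchild.waveCauchyProblem)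
    {M a : ℝ} (hMa : Kerr.IsSubextremal M a) {ψ : Kerr.exterior M a → ℝ}
    (hψ : IsAdmissibleKerrWave M a ψ) {r₀ : ℝ} (hr₀ : 0 < r₀) (hr₀' : r₀ ≤ Kerr.rPlus M a) :
    ∃ Ψ : Kerr.region a r₀ → ℝ, ContMDiff 𝓘(ℝ, E4) 𝓘(ℝ, ℝ) ∞ Ψ ∧
      (∀ x, (Kerr.smoothMetric M a r₀).toPseudoRiemannianMetric.dalembertian Ψ x = 0) ∧
      (∃ K : Set E3, IsCompact K ∧ K ⊆ (Kerr.slice a (Kerr.rPlus M a) : Set E3) ∧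
        ∀ x : Kerr.region a r₀, (x : E4) 0 = 0 → E4.spatial (x : E4) ∉ K →
          Ψ x = 0 ∧ mfderiv 𝓘(ℝ, E4) 𝓘(ℝ, ℝ) Ψ x = 0) ∧
      ∀ x : Kerr.exterior M a, 0 ≤ (x : E4) 0 → ψ x = Ψ ⟨x, Kerr.region_mono a hr₀' x.2⟩ := by
  classical
  have hM : 0 ≤ M := hMa.pos.le
  have hrp : 0 < Kerr.rPlus M a := hMa.rPlus_pos
  have hle2 : ((2 : ℕ∞) : WithTop ℕ∞) ≤ ((⊤ : ℕ∞) : WithTop ℕ∞) := WithTop.coe_le_coe.mpr le_top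
  obtain ⟨K, ψ₀, ψ₁, hK, hKs, hψ₀, hψ₁, h0K, h1K, hsl⟩ := hψ.exists_sliceData
  have hKc : IsClosed K := hK.isClosed
  have hc₀ : HasCompactSupport ψ₀ := HasCompactSupport.intro hK h0K
  have hc₁ : HasCompactSupport ψ₁ := HasCompactSupport.intro hK h1K
  obtain ⟨Ψ, hΨs, hΨw, hΨd, -⟩ := Kerr.exists_wave_of_data h hM a hr₀ hψ₀ hψ₁ hc₀ hc₁
  -- the inclusion of the exterior in the chart `{r > r₀}`
  have hincl : ∀ z : Kerr.exterior M a, (z : E4) ∈ Kerr.region a r₀ := fun z ↦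
    Kerr.region_mono a hr₀' z.2
  -- representatives on `E4`
  have hrepψ : ∀ z : Kerr.exterior M a, ψ z = Function.extend Subtype.val ψ 0 z := extend_rep ψ
  have hΦs : ∀ z : Kerr.exterior M a, ContDiffAt ℝ ∞ (Function.extend Subtype.val ψ 0) z :=
    contDiffAt_extend hψ.contMDiff
  generalize Function.extend Subtype.val ψ 0 = Φ at hrepψ hΦs hsl
  have hrepΨ : ∀ z : Kerr.region a r₀, Ψ z = Function.extend Subtype.val Ψ 0 z := extend_rep Ψ
  have hΨhs : ∀ z : Kerr.region a r₀, ContDiffAt ℝ ∞ (Function.extend Subtype.val Ψ 0) z :=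
    contDiffAt_extend hΨs
  have hΨoff : ∀ y : E3, y ∉ Kerr.slice a r₀ →
      Function.extend Subtype.val Ψ 0 (E4.ofTimeSpace 0 y) = 0 := fun y hy ↦
    extend_of_not_mem Ψ hy
  generalize Function.extend Subtype.val Ψ 0 = Ψh at hrepΨ hΨhs hΨoff
  -- data of the representative of `Ψ` on the chart slice
  have hΨh0 : ∀ y : E3, y ∈ Kerr.slice a r₀ → Ψh (E4.ofTimeSpace 0 y) = ψ₀ y := by
    intro y hy
    have h1 := (hΨd ⟨E4.ofTimeSpace 0 y, hy⟩ (by simp)).1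
    rw [hrepΨ] at h1
    simpa using h1
  have hΨh1 : ∀ y : E3, y ∈ Kerr.slice a r₀ →
      fderiv ℝ Ψh (E4.ofTimeSpace 0 y) (E4.basisVector 0) = ψ₁ y := by
    intro y hy
    have h2 := (hΨd ⟨E4.ofTimeSpace 0 y, hy⟩ (by simp)).2
    rw [OpensChart.mfderiv_eq _ Ψ Ψh hrepΨ ((hΨhs _).differentiableAt (by simp))] at h2
    have h3 : fderiv ℝ Ψh (E4.ofTimeSpace 0 y) (E4.basisVector 0) =
        ψ₁ (E4.spatial (E4.ofTimeSpace 0 y)) := h2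
    simpa using h3
  refine ⟨Ψ, hΨs, hΨw, ⟨K, hK, hKs, fun x hx0 hxK ↦ ?_⟩, fun x hx0 ↦ ?_⟩
  · -- the data of `Ψ` vanish off `K`
    have hx : E4.ofTimeSpace 0 (E4.spatial (x : E4)) = x := Kerr.ofTimeSpace_spatial_eq hx0
    have hys : E4.spatial (x : E4) ∈ Kerr.slice a r₀ := Kerr.spatial_mem_slice x
    refine ⟨?_, ?_⟩
    · rw [(hΨd x hx0).1]
      exact h0K _ hxK
    · have hdiff : DifferentiableAt ℝ Ψh x := (hΨhs x).differentiableAt (by simp)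
      rw [OpensChart.mfderiv_eq x Ψ Ψh hrepΨ hdiff]
      refine (?_ : fderiv ℝ Ψh (x : E4) = (0 : E4 →L[ℝ] ℝ))
      have hdiff' : DifferentiableAt ℝ Ψh (E4.ofTimeSpace 0 (E4.spatial (x : E4))) := by
        rw [hx]; exact hdiff
      have key := E4.fderiv_eq_of_data_eventuallyEq (G := fun _ ↦ (0 : ℝ)) hdiff'
        (differentiableAt_const _) ?_ ?_
      · rw [hx] at key
        rw [key]
        simp
      · filter_upwards [hKc.isOpen_compl.mem_nhds hxK] with y hy
        by_cases hys' : y ∈ Kerr.slice a r₀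
        · rw [hΨh0 y hys']
          exact h0K y hy
        · exact hΨoff y hys'
      · rw [hΨh1 _ hys, h1K _ hxK]
        simp
  · -- agreement on `{t* ≥ 0}`: domain of dependence for the difference
    let w : Kerr.exterior M a → ℝ := fun z ↦ ψ z - Ψ ⟨z, hincl z⟩
    have hwrep : ∀ z : Kerr.exterior M a, w z = (Φ - Ψh) z := fun z ↦ by
      simp only [w, Pi.sub_apply]
      rw [hrepψ z, hrepΨ ⟨z, hincl z⟩]
    have hw2 : ∀ z : Kerr.exterior M a, ContDiffAt ℝ ∞ (Φ - Ψh) z := fun z ↦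
      (hΦs z).sub (hΨhs ⟨z, hincl z⟩)
    have hws : ContMDiff 𝓘(ℝ, E4) 𝓘(ℝ, ℝ) ∞ w := fun z ↦
      (OpensChart.contMDiffAt_iff z w (Φ - Ψh) hwrep).mpr (hw2 z)
    -- the equation, through the surgered background `B` of `{r > r₊}`
    have hB := fun z : Kerr.exterior M a ↦
      Kerr.surgeryBackground_inverseMetric_eventuallyEq M a hM hrp z
    have hG : ∀ μ ν, Differentiable ℝ fun y ↦
        (Kerr.surgeryBackground M a (Kerr.rPlus M a) hM hrp).inverseMetric y μ ν := fun μ ν ↦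
      ((Kerr.surgeryBackground M a (Kerr.rPlus M a) hM hrp).contDiff_inverseMetric μ ν).differentiable
        (by simp)
    have hsolΦ : ∀ z : Kerr.exterior M a, KerrSchild.waveOperator
        (Kerr.surgeryBackground M a (Kerr.rPlus M a) hM hrp).inverseMetric Φ z = 0 := by
      intro z
      rw [← KerrSchild.waveOperator_congr_of_eventuallyEq (hB z) Φ,
        ← Kerr.dalembertian_eq_waveOperator M a (Kerr.rPlus M a) hrepψ z ((hΦs z).of_le hle2)]
      exact hψ.dalembertian_eq_zero z
    have hsolΨ : ∀ z : Kerr.exterior M a, KerrSchild.waveOperator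
        (Kerr.surgeryBackground M a (Kerr.rPlus M a) hM hrp).inverseMetric Ψh z = 0 := by
      intro z
      rw [← KerrSchild.waveOperator_congr_of_eventuallyEq (hB z) Ψh]
      have h1 := hΨw ⟨z, hincl z⟩
      rw [Kerr.dalembertian_eq_waveOperator M a r₀ hrepΨ ⟨(z : E4), hincl z⟩
        ((hΨhs ⟨z, hincl z⟩).of_le hle2)] at h1
      exact h1
    have hwwave : ∀ z, (Kerr.smoothMetric M a (Kerr.rPlus M a)).toPseudoRiemannianMetric.dalembertian
        w z = 0 := by
      intro z
      have hevΦ : ∀ᶠ y in 𝓝 (z : E4), ContDiffAt ℝ 2 Φ y := by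
        filter_upwards [(Kerr.exterior M a).isOpen.mem_nhds z.2] with y hy
        exact (hΦs ⟨y, hy⟩).of_le hle2
      have hevΨ : ∀ᶠ y in 𝓝 (z : E4), ContDiffAt ℝ 2 Ψh y := by
        filter_upwards [(Kerr.exterior M a).isOpen.mem_nhds z.2] with y hy
        exact (hΨhs ⟨y, hincl ⟨y, hy⟩⟩).of_le hle2
      rw [Kerr.dalembertian_eq_waveOperator M a (Kerr.rPlus M a) hwrep z ((hw2 z).of_le hle2),
        KerrSchild.waveOperator_congr_of_eventuallyEq (hB z) (Φ - Ψh),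
        KerrSchild.waveOperator_sub_local hG hevΦ hevΨ, hsolΦ z, hsolΨ z, sub_zero]
    -- the data of `w` vanish on the whole exterior slice
    have hwdata : ∀ z : Kerr.exterior M a, (z : E4) 0 = 0 →
        w z = 0 ∧ mfderiv 𝓘(ℝ, E4) 𝓘(ℝ, ℝ) w z = 0 := by
      intro z hz0
      have hz : E4.ofTimeSpace 0 (E4.spatial (z : E4)) = z := Kerr.ofTimeSpace_spatial_eq hz0
      have hzs : E4.spatial (z : E4) ∈ Kerr.slice a (Kerr.rPlus M a) := Kerr.spatial_mem_slice z
      have hzs' : E4.spatial (z : E4) ∈ Kerr.slice a r₀ :=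
        Kerr.spatial_mem_slice (⟨z, hincl z⟩ : Kerr.region a r₀)
      refine ⟨?_, ?_⟩
      · rw [hwrep z, Pi.sub_apply, ← hz, ← (hsl _ hzs).1, hΨh0 _ hzs', sub_self]
      · have hdΦ : DifferentiableAt ℝ Φ z := (hΦs z).differentiableAt (by simp)
        have hdΨ : DifferentiableAt ℝ Ψh z := (hΨhs ⟨z, hincl z⟩).differentiableAt (by simp)
        rw [OpensChart.mfderiv_eq z w (Φ - Ψh) hwrep (hdΦ.sub hdΨ)]
        refine (?_ : fderiv ℝ (Φ - Ψh) (z : E4) = (0 : E4 →L[ℝ] ℝ))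
        rw [fderiv_sub hdΦ hdΨ, sub_eq_zero]
        have hdΦ' : DifferentiableAt ℝ Φ (E4.ofTimeSpace 0 (E4.spatial (z : E4))) := by
          rw [hz]; exact hdΦ
        have hdΨ' : DifferentiableAt ℝ Ψh (E4.ofTimeSpace 0 (E4.spatial (z : E4))) := by
          rw [hz]; exact hdΨ
        have key := E4.fderiv_eq_of_data_eventuallyEq hdΦ' hdΨ' ?_ ?_
        · rwa [hz] at key
        · filter_upwards [(Kerr.slice a (Kerr.rPlus M a)).isOpen.mem_nhds hzs] with y hy
          have hy' : y ∈ Kerr.slice a r₀ := Kerr.region_mono a hr₀' hy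
          rw [← (hsl y hy).1, hΨh0 y hy']
        · rw [← (hsl _ hzs).2, hΨh1 _ hzs']
    have hvan := Kerr.vanish_of_data_ball hMa hws hwwave x hx0 (R := (x : E4) 0 + 1) (by linarith)
      (fun z hz0 _ ↦ hwdata z hz0)
    exact sub_eq_zero.mp hvan.1

end HorizonRegularExtension

/-! ### Transfer of the leaf functionals of fact A along agreement on `{t* ≥ 0}`

The functionals of fact A (`leafFlux`, `localLeafFlux`, `farLeafFlux`, `localLeafMass`,
`localError`, also for `Tψ`) through the leaves `Σ̃_τ(h)`, `τ ≥ 0`, of a non-negative height `h`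
only involve `ψ` and `dψ` at exterior points with `t* ≥ 0`; two smooth functions on the exterior
agreeing on `{t* ≥ 0}` — an admissible wave and the restriction of its horizon-regular extension —
therefore have the same functionals there (at the boundary points `t* = 0` the differential is
determined by the values on the closed half-space `{t* ≥ 0}`, which has the unique
differentiability property). -/

section NonnegTimeTransfer

/-- **One-sided agreement determines the differential.** If `F, G : E4 → ℝ` are differentiable
at a point `x` with `x⁰ ≥ 0` of an open set `U` and agree at all points of `U` with `t* ≥ 0`, then
`dF(x) = dG(x)` — also at the boundary points `x⁰ = 0`: the closed half-space `{t* ≥ 0}` is convex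
with non-empty interior, so it has the unique differentiability property, and the derivative
within it is determined by the values on it (Mathlib's `uniqueDiffOn_convex`,
`fderivWithin_congr`). [folklore] -/
theorem E4.fderiv_eq_of_eqOn_nonneg_time {F G : E4 → ℝ} {U : Set E4} (hU : IsOpen U) {x : E4}
    (hx : x ∈ U) (hx0 : 0 ≤ x 0) (hF : DifferentiableAt ℝ F x) (hG : DifferentiableAt ℝ G x)
    (h : ∀ y ∈ U, 0 ≤ y 0 → F y = G y) : fderiv ℝ F x = fderiv ℝ G x := by
  have hlin : IsLinearMap ℝ fun y : E4 ↦ y 0 :=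
    ⟨fun y y' ↦ by simp, fun c y ↦ by simp⟩
  have hconv : Convex ℝ {y : E4 | (0 : ℝ) ≤ y 0} := convex_halfSpace_ge hlin 0
  have hint : (interior {y : E4 | (0 : ℝ) ≤ y 0}).Nonempty := by
    refine ⟨E4.basisVector 0, ?_⟩
    have hopen : IsOpen {y : E4 | (0 : ℝ) < y 0} :=
      isOpen_lt continuous_const (contDiff_apply_zero (n := 0)).continuous
    have hsub : {y : E4 | (0 : ℝ) < y 0} ⊆ {y : E4 | (0 : ℝ) ≤ y 0} := fun y hy ↦
      Set.mem_setOf.mpr (le_of_lt (Set.mem_setOf.mp hy))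
    refine interior_mono hsub ?_
    rw [hopen.interior_eq]
    show (0 : ℝ) < E4.basisVector 0 0
    simp [E4.basisVector]
  have hu : UniqueDiffWithinAt ℝ ({y : E4 | (0 : ℝ) ≤ y 0} ∩ U) x :=
    (uniqueDiffOn_convex hconv hint x hx0).inter (hU.mem_nhds hx)
  rw [← hF.fderivWithin hu, ← hG.fderivWithin hu]
  exact fderivWithin_congr (fun y hy ↦ h y hy.2 hy.1) (h x hx hx0)

variable {U : Opens E4}

/-- **Manifold form**: two functions on an open subset `U` of the Kerr–Schild chart which are
differentiable at a point `x` with `t*(x) ≥ 0` and agree on `U ∩ {t* ≥ 0}` have the same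
differential at `x`. [folklore] -/
theorem OpensChart.mfderiv_eq_of_eqOn_nonneg_time {f g : U → ℝ} {x : U}
    (hf : MDifferentiableAt 𝓘(ℝ, E4) 𝓘(ℝ, ℝ) f x) (hg : MDifferentiableAt 𝓘(ℝ, E4) 𝓘(ℝ, ℝ) g x)
    (hx0 : 0 ≤ (x : E4) 0) (h : ∀ y : U, 0 ≤ (y : E4) 0 → f y = g y) :
    mfderiv 𝓘(ℝ, E4) 𝓘(ℝ, ℝ) f x = mfderiv 𝓘(ℝ, E4) 𝓘(ℝ, ℝ) g x := by
  have hF := (OpensChart.mdifferentiableAt_iff x f _ (extend_rep f)).mp hf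
  have hG := (OpensChart.mdifferentiableAt_iff x g _ (extend_rep g)).mp hg
  rw [OpensChart.mfderiv_eq x f _ (extend_rep f) hF, OpensChart.mfderiv_eq x g _ (extend_rep g) hG]
  exact E4.fderiv_eq_of_eqOn_nonneg_time U.isOpen x.2 hx0 hF hG fun y hy hy0 ↦ by
    rw [← extend_rep f ⟨y, hy⟩, ← extend_rep g ⟨y, hy⟩]
    exact h ⟨y, hy⟩ hy0

/-- The same for the differentials of the extensions by zero (the representatives used by
`timeDeriv`, `coordEnergyDensity`, …). [folklore] -/
theorem OpensChart.fderiv_extend_eq_of_eqOn_nonneg_time {f g : U → ℝ} {x : U}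
    (hf : MDifferentiableAt 𝓘(ℝ, E4) 𝓘(ℝ, ℝ) f x) (hg : MDifferentiableAt 𝓘(ℝ, E4) 𝓘(ℝ, ℝ) g x)
    (hx0 : 0 ≤ (x : E4) 0) (h : ∀ y : U, 0 ≤ (y : E4) 0 → f y = g y) :
    fderiv ℝ (Function.extend Subtype.val f 0) x = fderiv ℝ (Function.extend Subtype.val g 0) x := by
  have hF := (OpensChart.mdifferentiableAt_iff x f _ (extend_rep f)).mp hf
  have hG := (OpensChart.mdifferentiableAt_iff x g _ (extend_rep g)).mp hg
  exact E4.fderiv_eq_of_eqOn_nonneg_time U.isOpen x.2 hx0 hF hG fun y hy hy0 ↦ by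
    rw [← extend_rep f ⟨y, hy⟩, ← extend_rep g ⟨y, hy⟩]
    exact h ⟨y, hy⟩ hy0

/-- **Time derivatives agree on `{t* ≥ 0}`** for two smooth functions agreeing there; so the
transfer below applies again to `Tψ` (clauses (A5), (A6) of fact A). [folklore] -/
theorem timeDeriv_eq_of_eqOn_nonneg_time {f g : U → ℝ}
    (hf : ContMDiff 𝓘(ℝ, E4) 𝓘(ℝ, ℝ) ∞ f) (hg : ContMDiff 𝓘(ℝ, E4) 𝓘(ℝ, ℝ) ∞ g)
    (h : ∀ y : U, 0 ≤ (y : E4) 0 → f y = g y) (x : U) (hx0 : 0 ≤ (x : E4) 0) :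
    timeDeriv f x = timeDeriv g x := by
  simp only [timeDeriv]
  rw [OpensChart.fderiv_extend_eq_of_eqOn_nonneg_time (hf.mdifferentiableAt (by simp))
    (hg.mdifferentiableAt (by simp)) hx0 h]

namespace Kerr

variable [Facts]

/-- **The stress–energy tensor on `{t* ≥ 0}` only sees the solution there.** [folklore] -/
theorem stressEnergy_eq_of_eqOn_nonneg_time {M a : ℝ} {f g : region a (rPlus M a) → ℝ}
    {x : region a (rPlus M a)} (hf : MDifferentiableAt 𝓘(ℝ, E4) 𝓘(ℝ, ℝ) f x)
    (hg : MDifferentiableAt 𝓘(ℝ, E4) 𝓘(ℝ, ℝ) g x) (hx0 : 0 ≤ (x : E4) 0)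
    (h : ∀ y : region a (rPlus M a), 0 ≤ (y : E4) 0 → f y = g y) :
    (smoothMetric M a (rPlus M a)).stressEnergy f x = (smoothMetric M a (rPlus M a)).stressEnergy g x := by
  have hF := (OpensChart.mdifferentiableAt_iff x f _ (extend_rep f)).mp hf
  have hG := (OpensChart.mdifferentiableAt_iff x g _ (extend_rep g)).mp hg
  have hd := OpensChart.fderiv_extend_eq_of_eqOn_nonneg_time hf hg hx0 h
  have hmv : mvfderiv 𝓘(ℝ, E4) f x = mvfderiv 𝓘(ℝ, E4) g x := by
    refine ContinuousLinearMap.ext fun v ↦ ?_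
    rw [OpensChart.mvfderiv_eq x f _ (extend_rep f) hF v,
      OpensChart.mvfderiv_eq x g _ (extend_rep g) hG v, hd]
  unfold PseudoRiemannianMetric.stressEnergy PseudoRiemannianMetric.gradSq
  rw [hmv]

/-- **The leaf flux density over `y` through `Σ̃_τ(h)` only sees the solution on `{t* ≥ 0}`** when the
leaf point has `t* = τ + h(y) ≥ 0`. [folklore] -/
theorem leafFluxDensity_eq_of_eqOn_nonneg_time {M a : ℝ} (hgt : E3 → ℝ)
    {f g : region a (rPlus M a) → ℝ} (hf : ContMDiff 𝓘(ℝ, E4) 𝓘(ℝ, ℝ) ∞ f)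
    (hg : ContMDiff 𝓘(ℝ, E4) 𝓘(ℝ, ℝ) ∞ g)
    (h : ∀ y : region a (rPlus M a), 0 ≤ (y : E4) 0 → f y = g y) {τ : ℝ} {y : E3}
    (hτ : 0 ≤ τ + hgt y) :
    leafFluxDensity M a hgt f τ y = leafFluxDensity M a hgt g τ y := by
  by_cases hy : leafPoint hgt τ y ∈ region a (rPlus M a)
  · rw [leafFluxDensity_of_mem _ _ _ hy, leafFluxDensity_of_mem _ _ _ hy,
      stressEnergy_eq_of_eqOn_nonneg_time (hf.mdifferentiableAt (by simp))
        (hg.mdifferentiableAt (by simp)) (by simpa [leafPoint] using hτ) h]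
  · rw [leafFluxDensity_of_not_mem _ _ _ hy, leafFluxDensity_of_not_mem _ _ _ hy]

omit [Facts] in
/-- The same for the mass density (values only). [folklore] -/
theorem leafMassDensity_eq_of_eqOn_nonneg_time {M a : ℝ} (hgt : E3 → ℝ)
    {f g : region a (rPlus M a) → ℝ}
    (h : ∀ y : region a (rPlus M a), 0 ≤ (y : E4) 0 → f y = g y) {τ : ℝ} {y : E3}
    (hτ : 0 ≤ τ + hgt y) :
    leafMassDensity M a hgt f τ y = leafMassDensity M a hgt g τ y := by
  by_cases hy : leafPoint hgt τ y ∈ region a (rPlus M a)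
  · simp only [leafMassDensity, hy, dif_pos]
    rw [h ⟨leafPoint hgt τ y, hy⟩ (by simpa [leafPoint] using hτ)]
  · rw [leafMassDensity_of_not_mem _ _ _ hy, leafMassDensity_of_not_mem _ _ _ hy]

/-- **Transfer of the leaf functionals of fact A.** For a non-negative height `h` (e.g. `h♯_{R₁}`)
and two smooth functions on the exterior agreeing on `{t* ≥ 0}` — an admissible wave and the
restriction of its horizon-regular extension, `IsAdmissibleKerrWave.exists_horizonRegular_extension`
— the fluxes `leafFlux`, `localLeafFlux`, `farLeafFlux`, the local masses and the local error
functional through the leaves `Σ̃_τ(h)`, `τ ≥ 0`, coincide. [folklore] -/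
theorem leafFlux_eq_of_eqOn_nonneg_time {M a : ℝ} {hgt : E3 → ℝ} (hh : ∀ y, 0 ≤ hgt y)
    {f g : region a (rPlus M a) → ℝ} (hf : ContMDiff 𝓘(ℝ, E4) 𝓘(ℝ, ℝ) ∞ f)
    (hg : ContMDiff 𝓘(ℝ, E4) 𝓘(ℝ, ℝ) ∞ g)
    (h : ∀ y : region a (rPlus M a), 0 ≤ (y : E4) 0 → f y = g y) {τ : ℝ} (hτ : 0 ≤ τ) :
    leafFlux M a hgt f τ = leafFlux M a hgt g τ ∧
      (∀ R, localLeafFlux M a hgt f τ R = localLeafFlux M a hgt g τ R) ∧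
      (∀ R, farLeafFlux M a hgt f τ R = farLeafFlux M a hgt g τ R) ∧
      ∀ R, localLeafMass M a hgt f τ R = localLeafMass M a hgt g τ R := by
  have hd : leafFluxDensity M a hgt f τ = leafFluxDensity M a hgt g τ := funext fun y ↦
    leafFluxDensity_eq_of_eqOn_nonneg_time hgt hf hg h (add_nonneg hτ (hh y))
  have hm : leafMassDensity M a hgt f τ = leafMassDensity M a hgt g τ := funext fun y ↦
    leafMassDensity_eq_of_eqOn_nonneg_time hgt h (add_nonneg hτ (hh y))
  exact ⟨by rw [leafFlux, leafFlux, hd], fun R ↦ by rw [localLeafFlux, localLeafFlux, hd],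
    fun R ↦ by rw [farLeafFlux, farLeafFlux, hd], fun R ↦ by rw [localLeafMass, localLeafMass, hm]⟩

/-- Transfer of the local error functional `Loc_R(s, t)` for `s ≥ 0`. [folklore] -/
theorem localError_eq_of_eqOn_nonneg_time {M a : ℝ} {hgt : E3 → ℝ} (hh : ∀ y, 0 ≤ hgt y)
    {f g : region a (rPlus M a) → ℝ} (hf : ContMDiff 𝓘(ℝ, E4) 𝓘(ℝ, ℝ) ∞ f)
    (hg : ContMDiff 𝓘(ℝ, E4) 𝓘(ℝ, ℝ) ∞ g)
    (h : ∀ y : region a (rPlus M a), 0 ≤ (y : E4) 0 → f y = g y) (R : ℝ) {s : ℝ} (hs : 0 ≤ s)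
    (t : ℝ) : localError M a hgt f R s t = localError M a hgt g R s t := by
  simp only [localError]
  congr 1
  · refine setLIntegral_congr_fun measurableSet_Icc fun τ hτ ↦ ?_
    exact ((leafFlux_eq_of_eqOn_nonneg_time hh hf hg h (hs.trans hτ.1)).2.1 R)
  · refine setLIntegral_congr_fun measurableSet_Icc fun τ hτ ↦ ?_
    exact ((leafFlux_eq_of_eqOn_nonneg_time hh hf hg h (hs.trans hτ.1)).2.2.2 R)

/-- Transfer of the time integrals of clauses (A4), (A5), (A8) over `[s, t]`, `s ≥ 0`. [folklore] -/
theorem lintegral_Icc_leafFunctionals_eq_of_eqOn_nonneg_time {M a : ℝ} {hgt : E3 → ℝ}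
    (hh : ∀ y, 0 ≤ hgt y) {f g : region a (rPlus M a) → ℝ} (hf : ContMDiff 𝓘(ℝ, E4) 𝓘(ℝ, ℝ) ∞ f)
    (hg : ContMDiff 𝓘(ℝ, E4) 𝓘(ℝ, ℝ) ∞ g)
    (h : ∀ y : region a (rPlus M a), 0 ≤ (y : E4) 0 → f y = g y) (R : ℝ) {s : ℝ} (hs : 0 ≤ s)
    (t : ℝ) :
    (∫⁻ τ in Icc s t, localLeafFlux M a hgt f τ R = ∫⁻ τ in Icc s t, localLeafFlux M a hgt g τ R) ∧
      (∫⁻ τ in Icc s t, farLeafFlux M a hgt f τ R = ∫⁻ τ in Icc s t, farLeafFlux M a hgt g τ R) ∧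
      (∫⁻ τ in Icc s t, localLeafMass M a hgt f τ R =
        ∫⁻ τ in Icc s t, localLeafMass M a hgt g τ R) := by
  refine ⟨setLIntegral_congr_fun measurableSet_Icc fun τ hτ ↦ ?_,
    setLIntegral_congr_fun measurableSet_Icc fun τ hτ ↦ ?_,
    setLIntegral_congr_fun measurableSet_Icc fun τ hτ ↦ ?_⟩
  · exact (leafFlux_eq_of_eqOn_nonneg_time hh hf hg h (hs.trans hτ.1)).2.1 R
  · exact (leafFlux_eq_of_eqOn_nonneg_time hh hf hg h (hs.trans hτ.1)).2.2.1 R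
  · exact (leafFlux_eq_of_eqOn_nonneg_time hh hf hg h (hs.trans hτ.1)).2.2.2 R

end Kerr

end NonnegTimeTransfer

section HorizonRegularExtensionTransfer

/-- **Restriction to a smaller chart is smooth**: for open sets `U ≤ V` of the Kerr–Schild chart
and `f` of class `C^n` on `V`, `f|_U` is of class `C^n` (same representative). [folklore] -/
theorem OpensChart.contMDiff_restrict {U V : Opens E4} (hUV : U ≤ V) {f : V → ℝ} {n : ℕ∞ω}
    (hf : ContMDiff 𝓘(ℝ, E4) 𝓘(ℝ, ℝ) n f) :
    ContMDiff 𝓘(ℝ, E4) 𝓘(ℝ, ℝ) n fun z : U ↦ f ⟨z, hUV z.2⟩ := fun z ↦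
  (OpensChart.contMDiffAt_iff z (fun z : U ↦ f ⟨z, hUV z.2⟩) (Function.extend Subtype.val f 0)
      (fun y ↦ extend_rep f ⟨y, hUV y.2⟩)).mpr (contDiffAt_extend hf ⟨z, hUV z.2⟩)

variable [Kerr.Facts] [Kerr.SliceFacts]

/-- **Fact A's first-order functionals of an admissible wave are those of its horizon-regular
extension** (DRSR §4.1 for the vendored functionals). Under `KerrSchild.waveCauchyProblem`, for
`|a| < M`, `0 < r₀ ≤ r₊`, an admissible wave `ψ` and a non-negative height `h` (e.g. `h♯_{R₁}`,
`Kerr.scriHeight_nonneg`): with `Ψ` the smooth solution on `Kerr.region a r₀ ⊇ 𝓗⁺` of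
`IsAdmissibleKerrWave.exists_horizonRegular_extension` and `Ψ|` its restriction to the exterior,
for all `τ ≥ 0` the fluxes `leafFlux`, `localLeafFlux`, `farLeafFlux` and the local masses of `ψ`
and of `Ψ|` through `Σ̃_τ(h)` coincide, and likewise for `Tψ` and `T(Ψ|)`; hence every estimate of
these functionals proved for solutions of DRSR's class (smooth on a slab of the
horizon-penetrating chart, compactly supported data on a slice crossing `𝓗⁺`) holds for the
admissible wave. [cite: DafermosRodnianskiShlapentokhrothman2014, §4.1] -/
theorem IsAdmissibleKerrWave.exists_horizonRegular_extension_leafFunctionals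
    (h : KerrSchild.waveCauchyProblem) {M a : ℝ} (hMa : Kerr.IsSubextremal M a)
    {ψ : Kerr.exterior M a → ℝ} (hψ : IsAdmissibleKerrWave M a ψ) {r₀ : ℝ} (hr₀ : 0 < r₀)
    (hr₀' : r₀ ≤ Kerr.rPlus M a) {hgt : E3 → ℝ} (hh : ∀ y, 0 ≤ hgt y) :
    ∃ Ψ : Kerr.region a r₀ → ℝ, ContMDiff 𝓘(ℝ, E4) 𝓘(ℝ, ℝ) ∞ Ψ ∧
      (∀ x, (Kerr.smoothMetric M a r₀).toPseudoRiemannianMetric.dalembertian Ψ x = 0) ∧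
      (∃ K : Set E3, IsCompact K ∧ K ⊆ (Kerr.slice a (Kerr.rPlus M a) : Set E3) ∧
        ∀ x : Kerr.region a r₀, (x : E4) 0 = 0 → E4.spatial (x : E4) ∉ K →
          Ψ x = 0 ∧ mfderiv 𝓘(ℝ, E4) 𝓘(ℝ, ℝ) Ψ x = 0) ∧
      (∀ x : Kerr.exterior M a, 0 ≤ (x : E4) 0 → ψ x = Ψ ⟨x, Kerr.region_mono a hr₀' x.2⟩) ∧
      ∀ τ : ℝ, 0 ≤ τ →
        (Kerr.leafFlux M a hgt ψ τ =
            Kerr.leafFlux M a hgt (fun z : Kerr.exterior M a ↦ Ψ ⟨z, Kerr.region_mono a hr₀' z.2⟩) τ ∧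
          (∀ R, Kerr.localLeafFlux M a hgt ψ τ R =
            Kerr.localLeafFlux M a hgt (fun z : Kerr.exterior M a ↦ Ψ ⟨z, Kerr.region_mono a hr₀' z.2⟩) τ R) ∧
          (∀ R, Kerr.farLeafFlux M a hgt ψ τ R =
            Kerr.farLeafFlux M a hgt (fun z : Kerr.exterior M a ↦ Ψ ⟨z, Kerr.region_mono a hr₀' z.2⟩) τ R) ∧
          ∀ R, Kerr.localLeafMass M a hgt ψ τ R =
            Kerr.localLeafMass M a hgt (fun z : Kerr.exterior M a ↦ Ψ ⟨z, Kerr.region_mono a hr₀' z.2⟩) τ R) ∧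
        (Kerr.leafFlux M a hgt (Literature.Geometry.Lorentzian.timeDeriv ψ) τ =
            Kerr.leafFlux M a hgt
              (Literature.Geometry.Lorentzian.timeDeriv fun z : Kerr.exterior M a ↦
                Ψ ⟨z, Kerr.region_mono a hr₀' z.2⟩) τ ∧
          (∀ R, Kerr.localLeafFlux M a hgt (Literature.Geometry.Lorentzian.timeDeriv ψ) τ R =
            Kerr.localLeafFlux M a hgt
              (Literature.Geometry.Lorentzian.timeDeriv fun z : Kerr.exterior M a ↦
                Ψ ⟨z, Kerr.region_mono a hr₀' z.2⟩) τ R) ∧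
          (∀ R, Kerr.farLeafFlux M a hgt (Literature.Geometry.Lorentzian.timeDeriv ψ) τ R =
            Kerr.farLeafFlux M a hgt
              (Literature.Geometry.Lorentzian.timeDeriv fun z : Kerr.exterior M a ↦
                Ψ ⟨z, Kerr.region_mono a hr₀' z.2⟩) τ R) ∧
          ∀ R, Kerr.localLeafMass M a hgt (Literature.Geometry.Lorentzian.timeDeriv ψ) τ R =
            Kerr.localLeafMass M a hgt
              (Literature.Geometry.Lorentzian.timeDeriv fun z : Kerr.exterior M a ↦
                Ψ ⟨z, Kerr.region_mono a hr₀' z.2⟩) τ R) := by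
  obtain ⟨Ψ, hΨs, hΨw, hK, hagree⟩ := hψ.exists_horizonRegular_extension h hMa hr₀ hr₀'
  have hΨr : ContMDiff 𝓘(ℝ, E4) 𝓘(ℝ, ℝ) ∞
      fun z : Kerr.exterior M a ↦ Ψ ⟨z, Kerr.region_mono a hr₀' z.2⟩ :=
    OpensChart.contMDiff_restrict (Kerr.region_mono a hr₀') hΨs
  have hT : ∀ y : Kerr.exterior M a, 0 ≤ (y : E4) 0 →
      Literature.Geometry.Lorentzian.timeDeriv ψ y =
        Literature.Geometry.Lorentzian.timeDeriv
          (fun z : Kerr.exterior M a ↦ Ψ ⟨z, Kerr.region_mono a hr₀' z.2⟩) y :=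
    fun y hy ↦ timeDeriv_eq_of_eqOn_nonneg_time hψ.contMDiff hΨr hagree y hy
  refine ⟨Ψ, hΨs, hΨw, hK, hagree, fun τ hτ ↦ ⟨?_, ?_⟩⟩
  · exact Kerr.leafFlux_eq_of_eqOn_nonneg_time hh hψ.contMDiff hΨr hagree hτ
  · exact Kerr.leafFlux_eq_of_eqOn_nonneg_time hh (contMDiff_timeDeriv hψ.contMDiff)
      (contMDiff_timeDeriv hΨr) hT hτ

end HorizonRegularExtensionTransfer

end Literature.Geometry.Lorentzian

end
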